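import Literature.NumberTheory.LFunctions.HuxleyLargeValuesProofs
import Literature.NumberTheory.LFunctions.ZeroDensityIngham
import HarnessLib

/-!
# Huxley's zero-density theorem `N(σ, T) ≪ T^{(5σ−3)(1−σ)/(σ²+σ−1)+ε}` and the `12/5` density theorem

Trunk T-ANT (`Literature/NumberTheory/LFunctions`), family RH, statement **rh.S12**. Final file of the
decomposition of the named fact `Literature.NumberTheory.LFunctions.zeroDensity_huxley` (`ZeroCounting.lean`:
`N(σ, T) ≪_ε T^{(12/5)(1−σ)+ε}` for `1/2 ≤ σ ≤ 1`). Everything in this file is PROVED; the two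
headline results are the DISCHARGES

* `Literature.NumberTheory.LFunctions.Huxley1972_zeroDensity_holds : Huxley1972_zeroDensity` — Huxley, *The Distribution of
  Prime Numbers* (1972), Ch. 28, (28.19): `N(α, T) ≪ T^{(5α−3)(1−α)/(α²+α−1)} l^{27}`,
  `3/4 ≤ α ≤ 1`, in the `T^ε` form `ZeroDensityEstimate` of the tree (named fact of
  `ZeroDensityInghamHuxley.lean`);
* `Literature.NumberTheory.LFunctions.zeroDensity_huxley_holds : zeroDensity_huxley` — by the assembly
  `zeroDensity_huxley_of_ingham_of_huxley1972` (`ZeroDensityInghamHuxley.lean`, Huxley (28.30)) from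
  Ingham's theorem `zeroDensity_ingham_holds` (`ZeroDensityIngham.lean`) on `1/2 ≤ σ ≤ 3/4` and the
  previous item on `3/4 ≤ σ ≤ 1`.

The inputs, all proved in the tree: the zero-detection method with Mellin's kernel `Γ(w)`
(`HuxleyZeroDetection.lean`, Huxley Ch. 23), Huxley's large-values theorem (27.27)
(`Huxley1972_largeValues_holds`, `HuxleyLargeValuesProofs.lean`), the weak fourth moment
`∫_0^T |ζ(1/2+it)|⁴ dt ≪_ε T^{1+ε}` (`zetaFourthMomentWeak`, `ZetaFourthMomentWeak.lean`, from the
approximate functional equation `Bourgain2017_eq43_holds`), the divisor bound `d(n) ≪_ε n^ε`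
(`Literature.NumberTheory.Sieve.exists_card_divisors_le_mul_rpow'`), and the counting layer of
`ZeroDensityInghamTools.lean` / `ZeroDensityIngham.lean` (unit windows by Jensen's inequality,
dyadic summation: `ZeroDensity.wellSpacedBound_of_eventually`, `count_dyadic_le`, `isBigO_of_dyadic`).

## The argument (Huxley Ch. 28, pp. 117–118) and the one deviation from it

For `3/4 ≤ σ < 1` (Huxley's `α`), `T = 2U` large, `l = log T`, and a set of zeros `ρ = β + iγ`,
`β ≥ σ`, `U < γ ≤ 2U`, with ordinates `≥ 300 l` apart ("we pick representatives … imaginary parts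
differ by at least `2l`", (28.1); here `300 l`, and the thinning costs a factor `≪ l`,
`card_le_of_thinning`), take `X = T^{(2σ−1)/(2(σ²+σ−1))}`, `Y = T^{(5σ−3)/(2(σ²+σ−1))}`
((28.17)–(28.18)). By the zero-detection identity every such zero is of class (i),
`|∑_{X<n≤100lY} a_X(n)e^{-n/Y}n^{-ρ}| > 1/3`, or of class (ii). Class (i) is counted block by block
with the large-values theorem at the points `s = ρ − σ`, `0 ≤ re s ≤ 1/4` ((28.13)–(28.16):
`≪ Y^{2−2σ} + X^{4−6σ}T` up to logarithms; `classOne_card_le`).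

*Deviation.* Huxley converts the class (ii) condition (28.3) into a pointwise large value
`|ζ(1/2+it)M_X(1/2+it)| > cY^{β−1/2}` at some `|t − γ| ≤ 100 l` (28.4) and counts the `t` with
`|ζ(1/2+it)| > U` by the *discrete* fourth moment (22.22), `≪ TU⁻⁴l⁵` (28.5)–(28.6) (the tree's
named fact `Huxley1972_fourthMoment_discrete`, not discharged). Here the class (ii) condition is kept
one step earlier, as the short integral `∫_{|y|≤100l} |ζ M_X(1/2+i(γ+y))| dy ≥ 2⁻²⁰(σ−1/2)Y^{β−1/2}`
(`zeroDetection_integral`, same proof as `HuxleyZeroDetection.zeroDetection`), and split by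
Cauchy–Schwarz (`classTwo_split`): either `∫_{|y|≤100l} |ζ|² ≥ λW` — these zeros are counted by
Cauchy–Schwarz once more and the *integral* fourth moment over the disjoint windows
`[γ−100l, γ+100l] ⊆ [0, 3U]`, giving `≪ T^{1+ε}(λW)⁻²`, the exact analogue of (28.6) with
`U² = λW` (`card_classTwoA_le`) — or `∫_{|y|≤100l} |M_X|² ≥ W/λ`, whence `|M_X(1/2+it)|² ≥ W/(200lλ)`
at the maximum point of the window, and these points (pairwise `≥ 100 l ≥ log X` apart) are counted
by the large-values theorem exactly as in (28.7)–(28.8) (`card_classTwoB_le`). With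
`λW = 2⁻²⁰(σ−1/2)T^{(1−κ)/2}`, i.e. Huxley's choice `TU⁻⁴ = T^κ`, `κ = (5σ−3)(1−σ)/(σ²+σ−1)`,
all five terms are `≪ l^{12} T^{κ+12η}` (`card_sep_le`; the exponent identities are
`huxley_exponents`), and the counting layer gives `N(σ, T) ≪_ε T^{κ+ε}`.

## Main statements (all proved)

* `HuxleyZeroDensity.zeroDetection_integral` — the dichotomy with the class (ii) condition as a short integral.
* `HuxleyZeroDensity.exists_block_largeValues_const`, `HuxleyZeroDensity.classOne_card_le` — class (i).
* `HuxleyZeroDensity.card_classTwoA_le`, `HuxleyZeroDensity.card_classTwoB_le` — class (ii).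
* `HuxleyZeroDensity.card_sep_le_raw`, `HuxleyZeroDensity.card_sep_le`, `HuxleyZeroDensity.wellSpaced_huxley`.
* `Huxley1972_zeroDensity_holds`, `zeroDensity_huxley_holds`.

No new definitions or named facts are introduced.

## References

* M. N. Huxley, *The Distribution of Prime Numbers. Large Sieves and Zero-Density Theorems*, Oxford
  Mathematical Monographs, Clarendon Press 1972, Ch. 23 ((23.13)–(23.14)), Ch. 27 (Theorem,
  (27.24)–(27.27)), Ch. 28 ((28.1)–(28.19), (28.30)).
* M. N. Huxley, *On the difference between consecutive primes*, Invent. Math. 15 (1972) 164–170.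
* A. Ivić, *The Riemann Zeta-Function*, Wiley 1985, Thm 11.1 (11.23)–(11.24).
* E. C. Titchmarsh, *The Theory of the Riemann Zeta-Function*, 2nd ed. 1986, §9.29.
* H. Iwaniec, E. Kowalski, *Analytic Number Theory*, AMS 2004, Ch. 10 (the cite carried by
  `zeroDensity_huxley`; not consulted).
-/

noncomputable section

open Real Set Filter Topology Complex MeasureTheory Finset Asymptotics

namespace Literature.NumberTheory.LFunctions

namespace HuxleyZeroDensity

open HuxleyZeroDetection
open ZeroDetect (mollifier mollCoeff mollCoeff_one mollCoeff_eq_zero norm_mollCoeff_le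
  norm_mollCoeff_le_self norm_mollifier_le differentiable_mollifier)

/-! ## §1. The zero-detection dichotomy with the class (ii) condition in integral form -/

/-- Continuity of `y ↦ ζ(1/2 + i(γ + y)) M_X(1/2 + i(γ + y))`. [folklore] -/
theorem continuous_zetaMoll_shift (X : ℕ) (γ : ℝ) :
    Continuous fun y : ℝ ↦ riemannZeta (1 / 2 + ((γ + y : ℝ) : ℂ) * I) *
      mollifier X (1 / 2 + ((γ + y : ℝ) : ℂ) * I) := by
  have h1 : Continuous fun y : ℝ ↦ riemannZeta (1 / 2 + ((γ + y : ℝ) : ℂ) * I) :=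
    FourthMoment.continuous_zeta_half_line'.comp (by fun_prop)
  have h2 : Continuous fun y : ℝ ↦ mollifier X (1 / 2 + ((γ + y : ℝ) : ℂ) * I) :=
    (ZeroDensity.continuous_mollifier_half_line X).comp (by fun_prop)
  exact h1.mul h2

/-- **The zero-detection dichotomy with the class (ii) condition as a short integral** (Huxley,
Ch. 23 and Ch. 28, (28.3): "the parts of the integrand with `|Im w| > 100 l` give less than `1/2` …").
Let `0 < δ`, `T ≥ 2³⁶/δ + 3`, `l = log T`, `1 ≤ X ≤ T²`, `10 ≤ Y ≤ T²`. Every zero `ρ = β + iγ` of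
`ζ` with `β ≥ 1/2 + δ`, `100 l ≤ |γ| ≤ T` is of class (i),
`|∑_{X < n ≤ 100 l Y} a_X(n) e^{-n/Y} n^{-ρ}| > 1/3`, or satisfies the class (ii) condition in the
integral form `∫_{-100 l}^{100 l} |ζ(1/2 + i(γ+y)) M_X(1/2 + i(γ+y))| dy ≥ 2⁻²⁰ δ Y^{β − 1/2}`.
(Same proof as `HuxleyZeroDetection.zeroDetection`, keeping the integral over `|y| ≤ 100 l`
instead of bounding it by a supremum.) [cite: Huxley1972, Ch. 28, (28.3)–(28.4)] -/
theorem zeroDetection_integral {δ : ℝ} (hδ : 0 < δ) {T : ℝ} (hT : 2 ^ 36 / δ + 3 ≤ T) {X : ℕ}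
    (hX : 1 ≤ X) (hXT : (X : ℝ) ≤ T ^ 2) {Y : ℝ} (hY : 10 ≤ Y) (hYT : Y ≤ T ^ 2) {ρ : ℂ}
    (hζ : riemannZeta ρ = 0) (hβ : 1 / 2 + δ ≤ ρ.re) (hγ : 100 * Real.log T ≤ |ρ.im|)
    (hγT : |ρ.im| ≤ T) :
    1 / 3 < ‖∑ n ∈ Finset.Ioc X ⌊100 * Real.log T * Y⌋₊,
        smoothed (mollCoeff X) Y n * (n : ℂ) ^ (-ρ)‖ ∨
      δ * Y ^ (ρ.re - 1 / 2) / 2 ^ 20 ≤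
        ∫ y in (-(100 * Real.log T))..(100 * Real.log T),
          ‖riemannZeta (1 / 2 + ((ρ.im + y : ℝ) : ℂ) * I) *
            mollifier X (1 / 2 + ((ρ.im + y : ℝ) : ℂ) * I)‖ := by
  -- parameters
  have hδpos : 0 < 2 ^ 36 / δ := by positivity
  have hT3 : 3 ≤ T := by linarith only [hT, hδpos]
  have hT1 : 1 ≤ T := by linarith only [hT3]
  have hTpos : 0 < T := by linarith only [hT3]
  have hδT : 2 ^ 36 ≤ δ * T := by
    have : 2 ^ 36 / δ ≤ T := by linarith only [hT, hδpos]
    rwa [div_le_iff₀' hδ] at this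
  set l : ℝ := Real.log T with hl
  have hl1 : 1 ≤ l := by
    rw [hl, Real.le_log_iff_exp_le (by linarith)]; linarith [Real.exp_one_lt_d9]
  set A : ℝ := 100 * l with hA
  have hA100 : 100 ≤ A := by rw [hA]; linarith only [hl1]
  have hA0 : 0 ≤ A := by linarith only [hA100]
  set N₀ : ℕ := ⌊A * Y⌋₊ with hN₀
  have hY1 : 1 ≤ Y := by linarith only [hY]
  have hY0 : 0 < Y := by linarith only [hY]
  have hN₀1 : 1 ≤ N₀ := by
    rw [hN₀, Nat.one_le_floor_iff]; nlinarith only [hA100, hY]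
  have hN₀A : A * Y ≤ (N₀ : ℝ) + 1 := (Nat.lt_floor_add_one (A * Y)).le
  have hβ' : 1 / 2 < ρ.re := by linarith only [hβ, hδ]
  have hβ1 := LFunctions.re_lt_one_of_riemannZeta_eq_zero hζ
  set κ : ℝ := ρ.re - 1 / 2 with hκ
  have hκδ : δ ≤ κ := by rw [hκ]; linarith only [hβ]
  have hκ0 : 0 < κ := hδ.trans_le hκδ
  have hδ2 : δ < 1 / 2 := by have h' := hκδ; rw [hκ] at h'; linarith only [h', hβ1]
  have hTbig : 2 ^ 37 ≤ T := by nlinarith only [hδT, hδ2, hTpos]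
  have hγ1 : 1 ≤ |ρ.im| := by linarith only [hγ, hA100]
  have hρ0 : 0 ≤ ρ.re := by linarith only [hβ']
  -- `e^{-k l} T^k = 1`
  have hTl : Real.exp l = T := by rw [hl]; exact Real.exp_log hTpos
  have hpow : ∀ k : ℕ, Real.exp (-((k : ℝ) * l)) * T ^ k = 1 := fun k ↦ by
    rw [Real.exp_neg, Real.exp_nat_mul, hTl, inv_mul_cancel₀ (pow_ne_zero _ hTpos.ne')]
  clear_value l N₀ κ
  -- suppose neither alternative holds
  by_contra hcon
  simp only [not_or, not_lt, not_le] at hcon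
  obtain ⟨hB, hsmallI⟩ := hcon
  -- the short integral
  set g : ℝ → ℝ := fun y ↦ ‖riemannZeta (1 / 2 + ((ρ.im + y : ℝ) : ℂ) * I) *
      mollifier X (1 / 2 + ((ρ.im + y : ℝ) : ℂ) * I)‖ with hg
  have hgc : Continuous g := (continuous_zetaMoll_shift X ρ.im).norm
  have hg0 : ∀ y, 0 ≤ g y := fun y ↦ norm_nonneg _
  set IA : ℝ := ∫ y in (-A)..A, g y with hIA
  have hIA0 : 0 ≤ IA := intervalIntegral.integral_nonneg (by linarith) fun y _ ↦ hg0 y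
  have hsmallI' : IA < δ * Y ^ κ / 2 ^ 20 := hsmallI
  -- (1) the integral on `re w = 1/2 - β` is less than `1`
  have hI : ‖∫ y : ℝ, zdIntegrand ρ X Y ((1 / 2 - ρ.re : ℝ) + y * I)‖ < 1 := by
    set P : ℝ := Y ^ (1 / 2 - ρ.re) * (12 / κ) * 2 ^ 16 with hP
    have hP0 : 0 ≤ P := by positivity
    set Q : ℝ := 192 * X * (1 + |ρ.im|) ^ 3 * Real.exp (-(A / 2)) with hQ
    have hQ0 : 0 ≤ Q := by positivity
    -- the majorant
    set G : ℝ → ℝ := fun y ↦ P * (Set.indicator (Set.Icc (-A) A) g y + Q * Real.exp (-(|y| / 2)))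
      with hG
    have hind : Integrable (Set.indicator (Set.Icc (-A) A) g) :=
      (hgc.integrableOn_Icc (a := -A) (b := A)).integrable_indicator measurableSet_Icc
    have hGint : Integrable G := (hind.add (integrable_exp_neg_half_abs.const_mul Q)).const_mul P
    have hGval : ∫ y, G y = P * (IA + 4 * Q) := by
      rw [hG, integral_const_mul, integral_add hind (integrable_exp_neg_half_abs.const_mul Q),
        integral_const_mul, integral_exp_neg_half_abs, integral_indicator measurableSet_Icc,
        integral_Icc_eq_integral_Ioc, ← intervalIntegral.integral_of_le (by linarith), hIA]
      ring
    -- pointwise domination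
    have hdom : ∀ y : ℝ, ‖zdIntegrand ρ X Y ((1 / 2 - ρ.re : ℝ) + y * I)‖ ≤ G y := by
      intro y
      have hpe := poly_exp_le y
      have hE1 : Real.exp (-|y|) ≤ 1 := by
        rw [Real.exp_le_one_iff]; exact neg_nonpos.2 (abs_nonneg y)
      have hE2 : 0 ≤ Real.exp (-(|y| / 2)) := (Real.exp_pos _).le
      have h25 : (1 + |y|) ^ 2 * Real.exp (-(π * |y| / 2)) ≤ 2 ^ 16 := by
        have h1 : (1 : ℝ) ≤ 1 + |y| := by linarith [abs_nonneg y]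
        have : (1 + |y|) ^ 2 ≤ (1 + |y|) ^ 5 := pow_le_pow_right₀ h1 (by norm_num)
        calc (1 + |y|) ^ 2 * Real.exp (-(π * |y| / 2)) ≤ (1 + |y|) ^ 5 * Real.exp (-(π * |y| / 2)) :=
              mul_le_mul_of_nonneg_right this (Real.exp_pos _).le
          _ ≤ 2 ^ 16 * Real.exp (-|y|) := hpe
          _ ≤ 2 ^ 16 * 1 := by gcongr
          _ = 2 ^ 16 := by ring
      have hind0 : 0 ≤ Set.indicator (Set.Icc (-A) A) g y :=
        Set.indicator_nonneg (fun y _ ↦ hg0 y) y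
      rcases le_or_gt |y| A with hyA | hyA
      · -- `|y| ≤ A`
        have hyI : y ∈ Set.Icc (-A) A := ⟨by linarith [neg_abs_le y], le_trans (le_abs_self y) hyA⟩
        refine (norm_zdIntegrand_line_le' hζ hβ' X hY1 y).trans ?_
        rw [← hκ]
        calc 12 / κ * (1 + |y|) ^ 2 * Real.exp (-(π * |y| / 2)) * Y ^ (1 / 2 - ρ.re) * g y
            ≤ 12 / κ * 2 ^ 16 * Y ^ (1 / 2 - ρ.re) * g y := by
              have : 12 / κ * (1 + |y|) ^ 2 * Real.exp (-(π * |y| / 2)) =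
                  12 / κ * ((1 + |y|) ^ 2 * Real.exp (-(π * |y| / 2))) := by ring
              rw [this]
              have hgy := hg0 y
              gcongr
          _ = P * Set.indicator (Set.Icc (-A) A) g y := by
              rw [hP, Set.indicator_of_mem hyI]; ring
          _ ≤ G y := by
              rw [hG]; dsimp only
              rw [mul_add]
              linarith only [mul_nonneg hP0 (mul_nonneg hQ0 hE2)]
      · -- `|y| > A`: the trivial bound
        refine (norm_zdIntegrand_line_le hζ hβ' X hY1 y).trans ?_
        have hsplit : Real.exp (-|y|) ≤ Real.exp (-(A / 2)) * Real.exp (-(|y| / 2)) := by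
          rw [← Real.exp_add, Real.exp_le_exp]; linarith
        calc 2304 / (ρ.re - 1 / 2) * X * (1 + |ρ.im|) ^ 3 * Y ^ (1 / 2 - ρ.re) *
              ((1 + |y|) ^ 5 * Real.exp (-(π * |y| / 2)))
            ≤ 2304 / κ * X * (1 + |ρ.im|) ^ 3 * Y ^ (1 / 2 - ρ.re) *
                (2 ^ 16 * (Real.exp (-(A / 2)) * Real.exp (-(|y| / 2)))) := by
              rw [← hκ]
              refine mul_le_mul_of_nonneg_left (hpe.trans ?_) (by positivity)
              exact mul_le_mul_of_nonneg_left hsplit (by norm_num)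
          _ = P * (Q * Real.exp (-(|y| / 2))) := by rw [hP, hQ]; ring
          _ ≤ G y := by
              rw [hG]; dsimp only
              rw [mul_add]
              linarith only [mul_nonneg hP0 hind0]
    -- `P · IA ≤ 3/4 · (IA / (δ Y^κ / 2^20))`, `< 3/4`
    have hYκ : Y ^ (1 / 2 - ρ.re) * Y ^ κ = 1 := by
      rw [hκ, ← Real.rpow_add hY0]; norm_num
    have h1 : P * IA < 3 / 4 := by
      have hPpos : 0 < P := by positivity
      have hδκ : δ / κ ≤ 1 := (div_le_one hκ0).2 hκδ
      calc P * IA < P * (δ * Y ^ κ / 2 ^ 20) := mul_lt_mul_of_pos_left hsmallI' hPpos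
        _ = 3 / 4 * (δ / κ) * (Y ^ (1 / 2 - ρ.re) * Y ^ κ) := by rw [hP]; ring
        _ = 3 / 4 * (δ / κ) := by rw [hYκ, mul_one]
        _ ≤ 3 / 4 * 1 := by gcongr
        _ = 3 / 4 := by norm_num
    -- `4 P Q ≤ 1/4`
    have h2 : P * (4 * Q) ≤ 1 / 4 := by
      have hA2 : Real.exp (-(A / 2)) = Real.exp (-((50 : ℕ) * l)) := by
        congr 1; rw [hA]; push_cast; ring
      have h50 := hpow 50
      rw [← hA2] at h50
      have hE : Real.exp (-(A / 2)) = 1 / T ^ 50 := by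
        field_simp; linarith only [h50]
      have hγ3 : (1 + |ρ.im|) ^ 3 ≤ (2 * T) ^ 3 := by
        gcongr; linarith only [hγT, hT1]
      have hκ12 : 12 / κ ≤ 12 / δ := div_le_div_of_nonneg_left (by norm_num) hδ hκδ
      have hYκ1 : Y ^ (1 / 2 - ρ.re) ≤ 1 :=
        Real.rpow_le_one_of_one_le_of_nonpos hY1 (by linarith)
      calc P * (4 * Q) = Y ^ (1 / 2 - ρ.re) * (12 / κ) * 2 ^ 16 *
            (768 * X * (1 + |ρ.im|) ^ 3 * Real.exp (-(A / 2))) := by rw [hP, hQ]; ring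
        _ ≤ 1 * (12 / δ) * 2 ^ 16 * (768 * T ^ 2 * (2 * T) ^ 3 * (1 / T ^ 50)) := by
            rw [hE]; gcongr
        _ = 9 * 2 ^ 29 / (δ * T ^ 45) := by
            have hT0 : T ≠ 0 := hTpos.ne'
            have e50 : T ^ 50 = T ^ 5 * T ^ 45 := by rw [← pow_add]
            rw [e50]
            field_simp
            ring
        _ ≤ 1 / 4 := by
            rw [div_le_div_iff₀ (by positivity) (by norm_num)]
            have hT44 : 1 ≤ T ^ 44 := one_le_pow₀ hT1
            have e : δ * T ^ 45 = (δ * T) * T ^ 44 := by ring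
            rw [e]
            have := mul_le_mul hδT hT44 (by norm_num) (by positivity)
            linarith only [this]
    calc ‖∫ y : ℝ, zdIntegrand ρ X Y ((1 / 2 - ρ.re : ℝ) + y * I)‖
        ≤ ∫ y : ℝ, ‖zdIntegrand ρ X Y ((1 / 2 - ρ.re : ℝ) + y * I)‖ := norm_integral_le_integral_norm _
      _ ≤ ∫ y, G y := integral_mono (integrable_zdIntegrand_line hζ hβ' X hY1).norm hGint hdom
      _ = P * IA + P * (4 * Q) := by rw [hGval]; ring
      _ < 3 / 4 + 1 / 4 := add_lt_add_of_lt_of_le h1 h2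
      _ = 1 := by norm_num
  -- (2) the residue term is at most `1/20`
  have hRes : ‖Complex.Gamma (1 - ρ) * mollifier X 1 * (Y : ℂ) ^ (1 - ρ)‖ ≤ 1 / 20 := by
    refine (norm_residue_le hζ hβ' X hY1 hγ1).trans ?_
    have hE : Real.exp (-(π * |ρ.im| / 2)) ≤ 1 / T ^ 100 := by
      have h100 := hpow 100
      have : Real.exp (-(π * |ρ.im| / 2)) ≤ Real.exp (-((100 : ℕ) * l)) := by
        rw [Real.exp_le_exp]
        have : |ρ.im| ≤ π * |ρ.im| / 2 := by nlinarith only [Real.pi_gt_three, abs_nonneg ρ.im]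
        push_cast; linarith only [this, hγ, hA]
      refine this.trans (le_of_eq ?_)
      field_simp; linarith only [h100]
    have hYβ : Y ^ (1 - ρ.re) ≤ T ^ 2 := by
      calc Y ^ (1 - ρ.re) ≤ Y ^ (1 : ℝ) := Real.rpow_le_rpow_of_exponent_le hY1 (by linarith)
        _ = Y := Real.rpow_one Y
        _ ≤ T ^ 2 := hYT
    have hγ2 : (1 + |ρ.im|) ^ 2 ≤ (2 * T) ^ 2 := by
      gcongr; linarith only [hγT, hT1]
    calc 3 * (1 + |ρ.im|) ^ 2 * Real.exp (-(π * |ρ.im| / 2)) * X * Y ^ (1 - ρ.re)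
        ≤ 3 * (2 * T) ^ 2 * (1 / T ^ 100) * T ^ 2 * T ^ 2 := by gcongr
      _ = 12 / T ^ 94 := by
          have hT0 : T ≠ 0 := hTpos.ne'
          have e100 : T ^ 100 = T ^ 6 * T ^ 94 := by rw [← pow_add]
          rw [e100]
          field_simp
          ring
      _ ≤ 12 / T := div_le_div_of_nonneg_left (by norm_num) hTpos (le_self_pow₀ hT1 (by norm_num))
      _ ≤ 1 / 20 := by rw [div_le_div_iff₀ hTpos (by norm_num)]; linarith only [hTbig]
  -- (3) the tail `n > N₀` is at most `1/20`
  have hTail : ‖∑' m : ℕ, LSeries.term (smoothed (mollCoeff X) Y) ρ (m + (N₀ + 1))‖ ≤ 1 / 20 := by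
    refine (norm_tsum_term_smoothed_le hρ0 X hY0 (N₀ + 1)).trans ?_
    have hr : Real.exp (-(1 / (2 * Y))) ^ (N₀ + 1) ≤ 1 / T ^ 50 := by
      rw [← Real.exp_nat_mul]
      have h50 := hpow 50
      have h1 : Real.exp ((N₀ + 1 : ℕ) * -(1 / (2 * Y))) ≤ Real.exp (-((50 : ℕ) * l)) := by
        rw [Real.exp_le_exp]
        have hN : (100 : ℝ) * l * Y ≤ ((N₀ + 1 : ℕ) : ℝ) := by
          have h' := hN₀A; rw [hA] at h'; push_cast; linarith only [h']
        have h2 : (50 : ℝ) * l ≤ ((N₀ + 1 : ℕ) : ℝ) * (1 / (2 * Y)) := by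
          rw [mul_one_div, le_div_iff₀ (by positivity)]; linarith only [hN]
        push_cast at h2 ⊢
        linarith only [h2]
      refine h1.trans (le_of_eq ?_)
      field_simp; linarith only [h50]
    have hY3 : Y * (1 + 2 * Y) ≤ 3 * T ^ 4 := by
      have hYY : Y * Y ≤ T ^ 2 * T ^ 2 := mul_le_mul hYT hYT hY0.le (by positivity)
      have hT2 : T ^ 2 ≤ T ^ 2 * T ^ 2 := le_mul_of_one_le_right (by positivity) (one_le_pow₀ hT1)
      nlinarith only [hYY, hT2, hYT, hY0]
    calc Y * (1 + 2 * Y) * Real.exp (-(1 / (2 * Y))) ^ (N₀ + 1) ≤ 3 * T ^ 4 * (1 / T ^ 50) := by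
          gcongr
      _ = 3 / T ^ 46 := by
          have hT0 : T ≠ 0 := hTpos.ne'
          have e50 : T ^ 50 = T ^ 4 * T ^ 46 := by rw [← pow_add]
          rw [e50]
          field_simp
      _ ≤ 3 / T := div_le_div_of_nonneg_left (by norm_num) hTpos (le_self_pow₀ hT1 (by norm_num))
      _ ≤ 1 / 20 := by rw [div_le_div_iff₀ hTpos (by norm_num)]; linarith only [hTbig]
  -- (4) the identity, and the contradiction
  have hid := zeroDetection_identity hζ hβ' hX hY1
  rw [LSeries_smoothed_eq hρ0 hX hY0 hN₀1 (N₀ := N₀)] at hid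
  set E : ℂ := (Real.exp (-(1 / Y)) : ℂ) with hE
  set B : ℂ := ∑ n ∈ Finset.Ioc X N₀, smoothed (mollCoeff X) Y n * (n : ℂ) ^ (-ρ) with hBdef
  set R : ℂ := ∑' m : ℕ, LSeries.term (smoothed (mollCoeff X) Y) ρ (m + (N₀ + 1)) with hR
  set J : ℂ := ∫ y : ℝ, zdIntegrand ρ X Y ((1 / 2 - ρ.re : ℝ) + y * I) with hJ
  set Res : ℂ := Complex.Gamma (1 - ρ) * mollifier X 1 * (Y : ℂ) ^ (1 - ρ) with hResdef
  clear_value E B R J Res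
  have hEq : 2 * (π : ℂ) * E = 2 * π * Res + J - 2 * π * B - 2 * π * R := by
    linear_combination hid
  have hE9 : (9 : ℝ) / 10 ≤ Real.exp (-(1 / Y)) := by
    have h1 := Real.add_one_le_exp (-(1 / Y))
    have h2 : 1 / Y ≤ 1 / 10 := one_div_le_one_div_of_le (by norm_num) hY
    linarith only [h1, h2]
  have hnE : ‖2 * (π : ℂ) * E‖ = 2 * π * Real.exp (-(1 / Y)) := by
    rw [hE, norm_mul, norm_mul, Complex.norm_real, Complex.norm_real, Complex.norm_ofNat,
      Real.norm_of_nonneg Real.pi_pos.le, Real.norm_of_nonneg (Real.exp_pos _).le]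
  have h2π : ‖(2 * π : ℂ)‖ = 2 * π := by
    rw [norm_mul, Complex.norm_real, Complex.norm_ofNat, Real.norm_of_nonneg Real.pi_pos.le]
  have hnRHS : ‖2 * π * Res + J - 2 * π * B - 2 * π * R‖ <
      2 * π * (1 / 20) + 1 + 2 * π * (1 / 3) + 2 * π * (1 / 20) := by
    have e1 : ‖2 * (π : ℂ) * Res‖ ≤ 2 * π * (1 / 20) := by
      rw [show 2 * (π : ℂ) * Res = (2 * π : ℂ) * Res by ring, norm_mul, h2π]
      exact mul_le_mul_of_nonneg_left hRes (by positivity)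
    have e2 : ‖2 * (π : ℂ) * B‖ ≤ 2 * π * (1 / 3) := by
      rw [show 2 * (π : ℂ) * B = (2 * π : ℂ) * B by ring, norm_mul, h2π]
      exact mul_le_mul_of_nonneg_left hB (by positivity)
    have e3 : ‖2 * (π : ℂ) * R‖ ≤ 2 * π * (1 / 20) := by
      rw [show 2 * (π : ℂ) * R = (2 * π : ℂ) * R by ring, norm_mul, h2π]
      exact mul_le_mul_of_nonneg_left hTail (by positivity)
    calc ‖2 * π * Res + J - 2 * π * B - 2 * π * R‖
        ≤ ‖2 * π * Res + J - 2 * π * B‖ + ‖2 * π * R‖ := norm_sub_le _ _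
      _ ≤ ‖2 * π * Res + J‖ + ‖2 * π * B‖ + ‖2 * π * R‖ := by gcongr; exact norm_sub_le _ _
      _ ≤ ‖2 * π * Res‖ + ‖J‖ + ‖2 * π * B‖ + ‖2 * π * R‖ := by gcongr; exact norm_add_le _ _
      _ < _ := by linarith only [e1, e2, e3, hI]
  have key : 2 * π * Real.exp (-(1 / Y)) < 2 * π * (1 / 20) + 1 + 2 * π * (1 / 3) + 2 * π * (1 / 20) := by
    rw [← hnE, hEq]; exact hnRHS
  have hE9' : 2 * π * (9 / 10) ≤ 2 * π * Real.exp (-(1 / Y)) :=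
    mul_le_mul_of_nonneg_left hE9 (by positivity)
  linarith only [key, hE9', Real.pi_gt_three]


/-! ## §2. Large values of a block of the zero-detecting polynomial (Huxley (28.13)–(28.15)) -/

/-- `n^{-ρ} = n^{-σ} · n^{-(ρ - σ)}` for `n ≥ 1`. [folklore] -/
theorem natCast_cpow_neg_eq_mul (n : ℕ) (hn : n ≠ 0) (ρ : ℂ) (σ : ℝ) :
    (n : ℂ) ^ (-ρ) = (((n : ℝ) ^ (-σ) : ℝ) : ℂ) * (n : ℂ) ^ (-(ρ - σ)) := by
  have hn0 : (n : ℂ) ≠ 0 := by exact_mod_cast hn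
  have hn' : (0 : ℝ) ≤ n := Nat.cast_nonneg n
  rw [Complex.ofReal_cpow hn', Complex.ofReal_natCast, ← Complex.cpow_add _ _ hn0]
  congr 1
  push_cast
  ring

/-- **The block count by Huxley's large-values theorem** (Huxley Ch. 28, (28.13)–(28.15): "We pick
representatives and apply (27.28)"; here the theorem (27.27) itself, `Literature.NumberTheory.LFunctions.Huxley1972_largeValues`,
discharged in `HuxleyLargeValuesProofs.lean`). Let `M ≥ 1`, `T ≥ 1`, `V > 0`, and let `Z` be a
finite set of points `ρ = β + iγ` with `σ ≤ β ≤ σ + 1/3`, ordinates pairwise between `log 2M` and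
`T` apart, each with `|∑_{M<n≤2M} b(n) n^{-ρ}| ≥ V`. Then, with `G = ∑_{M<n≤2M} |b(n)|² n^{-2σ}`,
`|Z| ≤ C (G · 2M · V⁻² + G³ · 2M · T · V⁻⁶ log⁴(2MT))` with an absolute `C` (apply (27.27) to
`a(m) = b(m) m^{-σ}` on `(M, 2M]` and the points `s = ρ − σ`, `0 ≤ re s ≤ 1/3`).
[cite: Huxley1972, Ch. 28, (28.13)–(28.15)] -/
theorem exists_block_largeValues_const : ∃ C : ℝ, 0 ≤ C ∧
    ∀ (b : ℕ → ℂ) (M : ℕ) (σ T V : ℝ) (Z : Finset ℂ), 1 ≤ M → 1 ≤ T → 0 < V →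
    (∀ ρ ∈ Z, σ ≤ ρ.re ∧ ρ.re ≤ σ + 1 / 3) →
    (∀ ρ ∈ Z, ∀ ρ' ∈ Z, ρ ≠ ρ' → Real.log (2 * M) ≤ |ρ.im - ρ'.im| ∧ |ρ.im - ρ'.im| ≤ T) →
    (∀ ρ ∈ Z, V ≤ ‖∑ n ∈ Finset.Ioc M (2 * M), b n * (n : ℂ) ^ (-ρ)‖) →
    (Z.card : ℝ) ≤ C *
      ((∑ n ∈ Finset.Ioc M (2 * M), ‖b n‖ ^ 2 * (n : ℝ) ^ (-2 * σ)) * (2 * M) * V⁻¹ ^ 2 +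
        (∑ n ∈ Finset.Ioc M (2 * M), ‖b n‖ ^ 2 * (n : ℝ) ^ (-2 * σ)) ^ 3 * (2 * M) * T * V⁻¹ ^ 6 *
          Real.log (2 * M * T) ^ 4) := by
  classical
  obtain ⟨C, hC⟩ := Huxley1972_largeValues_holds
  -- `C ≥ 0` is forced by a one-point example; simpler to replace `C` by `max C 0`
  refine ⟨max C 0, le_max_right _ _, fun b M σ T V Z hM hT hV hre hsep hlarge ↦ ?_⟩
  set N : ℕ := 2 * M with hN
  have hN2 : 2 ≤ N := by omega
  set a : ℕ → ℂ := fun m ↦ if M < m then b m * (((m : ℝ) ^ (-σ) : ℝ) : ℂ) else 0 with ha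
  set S : Finset ℂ := Z.image (fun ρ ↦ ρ - (σ : ℂ)) with hS
  have hcard : S.card = Z.card := Finset.card_image_of_injective _ (sub_left_injective)
  -- the Dirichlet polynomial at `s = ρ - σ`
  have hsumeq : ∀ ρ : ℂ, ∑ m ∈ Finset.Icc 1 N, a m * (m : ℂ) ^ (-(ρ - σ)) =
      ∑ n ∈ Finset.Ioc M (2 * M), b n * (n : ℂ) ^ (-ρ) := by
    intro ρ
    have hfilter : (Finset.Icc 1 N).filter (fun m ↦ M < m) = Finset.Ioc M (2 * M) := by
      ext m; simp [hN]; omega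
    rw [← hfilter, Finset.sum_filter]
    refine Finset.sum_congr rfl fun m hm ↦ ?_
    simp only [Finset.mem_Icc] at hm
    rw [ha]; dsimp only
    split_ifs with h
    · rw [natCast_cpow_neg_eq_mul m (by omega) ρ σ]; ring
    · simp
  -- `G`
  have hGeq : ∑ m ∈ Finset.Icc 1 N, ‖a m‖ ^ 2 =
      ∑ n ∈ Finset.Ioc M (2 * M), ‖b n‖ ^ 2 * (n : ℝ) ^ (-2 * σ) := by
    have hfilter : (Finset.Icc 1 N).filter (fun m ↦ M < m) = Finset.Ioc M (2 * M) := by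
      ext m; simp [hN]; omega
    rw [← hfilter, Finset.sum_filter]
    refine Finset.sum_congr rfl fun m hm ↦ ?_
    rw [ha]; dsimp only
    split_ifs with h
    · rw [norm_mul, mul_pow, Complex.norm_real, Real.norm_of_nonneg (Real.rpow_nonneg (Nat.cast_nonneg m) _),
        ZeroDensity.rpow_neg_sq (Nat.cast_nonneg m)]
    · simp
  -- hypotheses of the large-values theorem
  have h1 : ∀ s ∈ S, 0 ≤ s.re ∧ s.re ≤ 1 / 3 := by
    intro s hs
    rw [hS, Finset.mem_image] at hs
    obtain ⟨ρ, hρ, rfl⟩ := hs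
    have := hre ρ hρ
    simp only [Complex.sub_re, Complex.ofReal_re]
    constructor <;> linarith [this.1, this.2]
  have h2 : ∀ s ∈ S, ∀ s' ∈ S, s ≠ s' → Real.log N ≤ |s.im - s'.im| ∧ |s.im - s'.im| ≤ T := by
    intro s hs s' hs' hne
    rw [hS, Finset.mem_image] at hs hs'
    obtain ⟨ρ, hρ, rfl⟩ := hs
    obtain ⟨ρ', hρ', rfl⟩ := hs'
    have hne' : ρ ≠ ρ' := fun e ↦ hne (by rw [e])
    have := hsep ρ hρ ρ' hρ' hne'
    simp only [Complex.sub_im, Complex.ofReal_im, sub_zero]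
    rw [hN]; push_cast
    exact this
  have h3 : ∀ s ∈ S, V ≤ ‖∑ m ∈ Finset.Icc 1 N, a m * (m : ℂ) ^ (-s)‖ := by
    intro s hs
    rw [hS, Finset.mem_image] at hs
    obtain ⟨ρ, hρ, rfl⟩ := hs
    rw [hsumeq ρ]
    exact hlarge ρ hρ
  have hLV := hC N a T V S hN2 hT hV h1 h2 h3
  rw [hcard, hGeq] at hLV
  have hNcast : ((N : ℕ) : ℝ) = 2 * M := by rw [hN]; push_cast; ring
  rw [hNcast] at hLV
  refine hLV.trans ?_
  have hG0 : 0 ≤ ∑ n ∈ Finset.Ioc M (2 * M), ‖b n‖ ^ 2 * (n : ℝ) ^ (-2 * σ) :=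
    Finset.sum_nonneg fun n _ ↦ by positivity
  have hlog0 : 0 ≤ Real.log (2 * M * T) ^ 4 := by positivity
  have hbody : 0 ≤ (∑ n ∈ Finset.Ioc M (2 * M), ‖b n‖ ^ 2 * (n : ℝ) ^ (-2 * σ)) * (2 * M) * V⁻¹ ^ 2 +
      (∑ n ∈ Finset.Ioc M (2 * M), ‖b n‖ ^ 2 * (n : ℝ) ^ (-2 * σ)) ^ 3 * (2 * M) * T * V⁻¹ ^ 6 *
        Real.log (2 * M * T) ^ 4 := by positivity
  exact mul_le_mul_of_nonneg_right (le_max_left _ _) hbody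


/-! ## §3. Class (ii a): the mean square of `ζ` on the window is large — the fourth moment -/

/-- Continuity of `t ↦ ‖ζ(1/2 + it)‖ ^ k`. [folklore] -/
theorem continuous_norm_zeta_half_pow (k : ℕ) :
    Continuous fun t : ℝ ↦ ‖riemannZeta (1 / 2 + t * I)‖ ^ k :=
  FourthMoment.continuous_zeta_half_line'.norm.pow k

/-- **Class (ii a) count.** Let `1 ≤ U`, `0 < A ≤ U`, and let `Z` be a finite set of points
`ρ = β + iγ` with `U < γ ≤ 2U`, ordinates pairwise `≥ 2A` apart, such that for each of them
`∫_{-A}^{A} |ζ(1/2 + i(γ+y))|² dy ≥ W`. Then `|Z| W² ≤ 2A ∫_0^{3U} |ζ(1/2+it)|⁴ dt`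
(Cauchy–Schwarz on each window; the windows `[γ − A, γ + A] ⊆ [0, 3U]` are disjoint). With the
fourth moment `∫_0^T |ζ(1/2+it)|⁴ ≤ C₄ T^{1+η}` this is `≤ 2A C₄ (3U)^{1+η}`. (This replaces Huxley's
use of the discrete fourth moment (22.22) in (28.5)–(28.6).) [cite: Huxley1972, Ch. 28, (28.5)–(28.6)] -/
theorem card_classTwoA_le {U A W : ℝ} (hU : 1 ≤ U) (hA0 : 0 < A) (hAU : A ≤ U) (Z : Finset ℂ)
    (hZ : ∀ ρ ∈ Z, U < ρ.im ∧ ρ.im ≤ 2 * U)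
    (hsep : ∀ ρ ∈ Z, ∀ ρ' ∈ Z, ρ ≠ ρ' → 2 * A ≤ |ρ.im - ρ'.im|)
    (hlarge : ∀ ρ ∈ Z, W ≤ ∫ y in (-A)..A, ‖riemannZeta (1 / 2 + ((ρ.im + y : ℝ) : ℂ) * I)‖ ^ 2)
    {C₄ η : ℝ} (h4 : ∀ T : ℝ, 1 ≤ T → ∫ t in (0 : ℝ)..T, ‖riemannZeta (1 / 2 + t * I)‖ ^ 4 ≤ C₄ * T ^ (1 + η))
    (hW : 0 ≤ W) :
    (Z.card : ℝ) * W ^ 2 ≤ 2 * A * (C₄ * (3 * U) ^ (1 + η)) := by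
  classical
  set h : ℝ → ℝ := fun t ↦ ‖riemannZeta (1 / 2 + t * I)‖ ^ 4 with hh
  have hhc : Continuous h := continuous_norm_zeta_half_pow 4
  have hh0 : ∀ t, 0 ≤ h t := fun t ↦ by positivity
  -- Cauchy–Schwarz on each window
  have hwin : ∀ ρ ∈ Z, W ^ 2 ≤ 2 * A * ∫ t in (ρ.im - A)..(ρ.im + A), h t := by
    intro ρ hρ
    have hf : Continuous fun _ : ℝ ↦ (1 : ℝ) := continuous_const
    have hg : Continuous fun y : ℝ ↦ ‖riemannZeta (1 / 2 + ((ρ.im + y : ℝ) : ℂ) * I)‖ ^ 2 :=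
      ((FourthMoment.continuous_zeta_half_line'.comp (by fun_prop)).norm.pow 2)
    have hCS := ZeroDensity.sq_integral_mul_le (a := -A) (b := A) (by linarith) hf hg
    simp only [one_mul, one_pow, intervalIntegral.integral_const, smul_eq_mul, mul_one] at hCS
    have h1 : W ^ 2 ≤ (∫ y in (-A)..A, ‖riemannZeta (1 / 2 + ((ρ.im + y : ℝ) : ℂ) * I)‖ ^ 2) ^ 2 :=
      pow_le_pow_left₀ hW (hlarge ρ hρ) 2
    have h2 : ∫ y in (-A)..A, (‖riemannZeta (1 / 2 + ((ρ.im + y : ℝ) : ℂ) * I)‖ ^ 2) ^ 2 =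
        ∫ t in (ρ.im - A)..(ρ.im + A), h t := by
      have := intervalIntegral.integral_comp_add_left (fun t ↦ h t) ρ.im (a := -A) (b := A)
      rw [show ρ.im + -A = ρ.im - A by ring] at this
      rw [← this]
      refine intervalIntegral.integral_congr fun y _ ↦ ?_
      simp only [hh]
      push_cast
      ring
    calc W ^ 2 ≤ _ := h1
      _ ≤ (A - -A) * ∫ y in (-A)..A, (‖riemannZeta (1 / 2 + ((ρ.im + y : ℝ) : ℂ) * I)‖ ^ 2) ^ 2 := hCS
      _ = 2 * A * ∫ t in (ρ.im - A)..(ρ.im + A), h t := by rw [h2]; ring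
  -- the windows are disjoint and inside `[0, 3U]`
  set 𝒯 : Finset ℝ := Z.image Complex.im with h𝒯
  have hinj : Set.InjOn Complex.im (Z : Set ℂ) := by
    intro ρ hρ ρ' hρ' he
    by_contra hne
    have := hsep ρ hρ ρ' hρ' hne
    rw [he, sub_self, abs_zero] at this
    linarith
  have hsep𝒯 : ∀ x ∈ 𝒯, ∀ y ∈ 𝒯, x ≠ y → 2 * A ≤ |x - y| := by
    intro x hx y hy hne
    rw [h𝒯, Finset.mem_image] at hx hy
    obtain ⟨ρ, hρ, rfl⟩ := hx
    obtain ⟨ρ', hρ', rfl⟩ := hy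
    exact hsep ρ hρ ρ' hρ' fun e ↦ hne (by rw [e])
  have hmem𝒯 : ∀ x ∈ 𝒯, (U - A) + 2 * A / 2 ≤ x ∧ x ≤ (2 * U + A) - 2 * A / 2 := by
    intro x hx
    rw [h𝒯, Finset.mem_image] at hx
    obtain ⟨ρ, hρ, rfl⟩ := hx
    have := hZ ρ hρ
    constructor <;> linarith [this.1, this.2]
  have hdisj := Gallagher.sum_integral_le_integral_of_separated hhc hh0 (by positivity : 0 < 2 * A) 𝒯 hsep𝒯
    (U - A) (2 * U + A) (by linarith) hmem𝒯
  have hsumZ : ∑ ρ ∈ Z, ∫ t in (ρ.im - A)..(ρ.im + A), h t =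
      ∑ x ∈ 𝒯, ∫ t in (x - 2 * A / 2)..(x + 2 * A / 2), h t := by
    rw [h𝒯, Finset.sum_image hinj]
    refine Finset.sum_congr rfl fun ρ _ ↦ ?_
    rw [show 2 * A / 2 = A by ring]
  have hbig : ∫ t in (U - A)..(2 * U + A), h t ≤ ∫ t in (0 : ℝ)..(3 * U), h t :=
    intervalIntegral.integral_mono_interval (by linarith) (by linarith) (by linarith)
      (Eventually.of_forall hh0) (hhc.intervalIntegrable _ _)
  have h4U := h4 (3 * U) (by linarith)
  calc (Z.card : ℝ) * W ^ 2 = ∑ ρ ∈ Z, W ^ 2 := by rw [Finset.sum_const, nsmul_eq_mul]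
    _ ≤ ∑ ρ ∈ Z, 2 * A * ∫ t in (ρ.im - A)..(ρ.im + A), h t := Finset.sum_le_sum hwin
    _ = 2 * A * ∑ ρ ∈ Z, ∫ t in (ρ.im - A)..(ρ.im + A), h t := by rw [Finset.mul_sum]
    _ ≤ 2 * A * ∫ t in (0 : ℝ)..(3 * U), h t := by
        refine mul_le_mul_of_nonneg_left ?_ (by positivity)
        rw [hsumZ]; exact hdisj.trans hbig
    _ ≤ 2 * A * (C₄ * (3 * U) ^ (1 + η)) := mul_le_mul_of_nonneg_left h4U (by positivity)

/-! ## §4. Class (ii b): the mollifier is large on the window — Huxley's large-values theorem -/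

/-- `∑_{d ≤ X} |μ(d) d^{-1/2}|² ≤ 1 + log X`. [folklore] -/
theorem sum_norm_sq_moebius_rpow_le (X : ℕ) :
    ∑ d ∈ Finset.Icc 1 X, ‖((ArithmeticFunction.moebius d : ℤ) : ℂ) *
        ((((d : ℝ) ^ (-(1 / 2 : ℝ)) : ℝ) : ℂ))‖ ^ 2 ≤ 1 + Real.log X := by
  calc ∑ d ∈ Finset.Icc 1 X, ‖((ArithmeticFunction.moebius d : ℤ) : ℂ) *
        ((((d : ℝ) ^ (-(1 / 2 : ℝ)) : ℝ) : ℂ))‖ ^ 2 ≤ ∑ d ∈ Finset.Icc 1 X, (1 : ℝ) / d := by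
        refine Finset.sum_le_sum fun d hd ↦ ?_
        simp only [Finset.mem_Icc] at hd
        have hd0 : (0 : ℝ) < d := by exact_mod_cast hd.1
        rw [norm_mul, mul_pow, Complex.norm_real, Real.norm_of_nonneg (Real.rpow_nonneg hd0.le _),
          ← Real.rpow_natCast ((d : ℝ) ^ (-(1 / 2 : ℝ))), ← Real.rpow_mul hd0.le]
        have e : (-(1 / 2 : ℝ)) * ((2 : ℕ) : ℝ) = -1 := by norm_num
        rw [e, Real.rpow_neg_one, one_div]
        have hμ : ‖((ArithmeticFunction.moebius d : ℤ) : ℂ)‖ ^ 2 ≤ 1 := by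
          have := ZeroDetect.norm_moebiusTruncSeq_le d d
          rw [ZeroDetect.moebiusTruncSeq_apply, if_pos le_rfl] at this
          exact pow_le_one₀ (norm_nonneg _) this
        exact mul_le_of_le_one_left (by positivity) hμ
    _ ≤ 1 + Real.log X := by
        have h := harmonic_le_one_add_log X
        have e : ∑ d ∈ Finset.Icc 1 X, (1 : ℝ) / d = (harmonic X : ℝ) := by
          rw [harmonic_eq_sum_Icc]; push_cast
          exact Finset.sum_congr rfl fun d _ ↦ by simp
        rw [e]; exact h

/-- **Class (ii b) count** (Huxley Ch. 28, (28.7)–(28.8): "`|M(1/2+it)| ≥ V` … and by (27.28) the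
number of such `t` is `≪ XV⁻²l + XTV⁻⁶l⁷`"; here via (27.27) itself). Let `X ≥ 2`,
`0 < A` with `log X ≤ A`, `T₁ ≥ 0`, and let `Z` be a finite set of points `ρ = β + iγ` whose
ordinates are pairwise between `3A` and `T₁` apart, such that for each of them
`∫_{-A}^{A} |M_X(1/2 + i(γ+y))|² dy ≥ W > 0`. Picking in each window a point where `|M_X|²` is
maximal (`≥ W/2A`), the points are pairwise between `A ≥ log X` and `T₁ + 2A` apart, and the
large-values theorem with `G = ∑_{d ≤ X} μ(d)²/d ≤ 1 + log X` bounds `|Z|`. [cite: Huxley1972, Ch. 28, (28.7)–(28.8)] -/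
theorem card_classTwoB_le : ∃ C : ℝ, 0 ≤ C ∧
    ∀ (X : ℕ) (A T₁ W : ℝ) (Z : Finset ℂ), 2 ≤ X → 0 < A →
    Real.log X ≤ A → 0 ≤ T₁ → 1 ≤ T₁ + 2 * A → 0 < W →
    (∀ ρ ∈ Z, ∀ ρ' ∈ Z, ρ ≠ ρ' → 3 * A ≤ |ρ.im - ρ'.im| ∧ |ρ.im - ρ'.im| ≤ T₁) →
    (∀ ρ ∈ Z, W ≤ ∫ y in (-A)..A, ‖mollifier X (1 / 2 + ((ρ.im + y : ℝ) : ℂ) * I)‖ ^ 2) →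
    (Z.card : ℝ) ≤ C * ((1 + Real.log X) * X * (2 * A / W) +
      (1 + Real.log X) ^ 3 * X * (T₁ + 2 * A) * (2 * A / W) ^ 3 * Real.log (X * (T₁ + 2 * A)) ^ 4) := by
  classical
  obtain ⟨C, hC⟩ := Huxley1972_largeValues_holds
  refine ⟨max C 0, le_max_right _ _, fun X A T₁ W Z hX hA0 hAX hT₁ hT₁A hW hsep hlarge ↦ ?_⟩
  -- the maximum of `|M_X|²` on each window
  set f : ℂ → ℝ → ℝ := fun ρ y ↦ ‖mollifier X (1 / 2 + ((ρ.im + y : ℝ) : ℂ) * I)‖ ^ 2 with hf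
  have hfc : ∀ ρ, Continuous (f ρ) := fun ρ ↦
    ((ZeroDensity.continuous_mollifier_half_line X).comp (by fun_prop)).norm.pow 2
  have hmax : ∀ ρ : ℂ, ∃ y ∈ Set.Icc (-A) A, IsMaxOn (f ρ) (Set.Icc (-A) A) y := fun ρ ↦
    (isCompact_Icc (a := -A) (b := A)).exists_isMaxOn (Set.nonempty_Icc.2 (by linarith))
      (hfc ρ).continuousOn
  choose ystar hystar_mem hystar_max using hmax
  set tstar : ℂ → ℝ := fun ρ ↦ ρ.im + ystar ρ with htstar
  -- `f ρ (ystar ρ) ≥ W / (2A)`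
  have hval : ∀ ρ ∈ Z, W / (2 * A) ≤ ‖mollifier X (1 / 2 + ((tstar ρ : ℝ) : ℂ) * I)‖ ^ 2 := by
    intro ρ hρ
    have h1 : ∫ y in (-A)..A, f ρ y ≤ ∫ y in (-A)..A, f ρ (ystar ρ) :=
      intervalIntegral.integral_mono_on (by linarith) ((hfc ρ).intervalIntegrable _ _)
        (by simp) fun y hy ↦ hystar_max ρ hy
    rw [intervalIntegral.integral_const, smul_eq_mul] at h1
    have h2 := (hlarge ρ hρ).trans h1
    rw [div_le_iff₀ (by positivity)]
    calc W ≤ (A - -A) * f ρ (ystar ρ) := h2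
      _ = ‖mollifier X (1 / 2 + ((tstar ρ : ℝ) : ℂ) * I)‖ ^ 2 * (2 * A) := by
          rw [hf, htstar]; ring
  -- spacing of the points `tstar`
  have hyA : ∀ ρ, |ystar ρ| ≤ A := fun ρ ↦ abs_le.2 (hystar_mem ρ)
  have hsp : ∀ ρ ∈ Z, ∀ ρ' ∈ Z, ρ ≠ ρ' → A ≤ |tstar ρ - tstar ρ'| ∧ |tstar ρ - tstar ρ'| ≤ T₁ + 2 * A := by
    intro ρ hρ ρ' hρ' hne
    have h := hsep ρ hρ ρ' hρ' hne
    have e : tstar ρ - tstar ρ' = (ρ.im - ρ'.im) + (ystar ρ - ystar ρ') := by rw [htstar]; ring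
    have hyy : |ystar ρ - ystar ρ'| ≤ 2 * A := by
      calc |ystar ρ - ystar ρ'| ≤ |ystar ρ| + |ystar ρ'| := abs_sub _ _
        _ ≤ A + A := add_le_add (hyA ρ) (hyA ρ')
        _ = 2 * A := by ring
    rw [e]
    constructor
    · have := abs_sub_abs_le_abs_sub (ρ.im - ρ'.im) (-(ystar ρ - ystar ρ'))
      rw [abs_neg, sub_neg_eq_add] at this
      linarith [h.1]
    · calc |ρ.im - ρ'.im + (ystar ρ - ystar ρ')| ≤ |ρ.im - ρ'.im| + |ystar ρ - ystar ρ'| :=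
            abs_add_le _ _
        _ ≤ T₁ + 2 * A := add_le_add h.2 hyy
  -- the large-values theorem
  set a : ℕ → ℂ := fun d ↦ ((ArithmeticFunction.moebius d : ℤ) : ℂ) *
    ((((d : ℝ) ^ (-(1 / 2 : ℝ)) : ℝ) : ℂ)) with ha
  set S : Finset ℂ := Z.image (fun ρ ↦ ((tstar ρ : ℝ) : ℂ) * I) with hS
  have hinj : Set.InjOn (fun ρ ↦ ((tstar ρ : ℝ) : ℂ) * I) (Z : Set ℂ) := by
    intro ρ hρ ρ' hρ' he
    by_contra hne
    have h1 := (hsp ρ hρ ρ' hρ' hne).1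
    have : tstar ρ = tstar ρ' := by
      have := congrArg Complex.im he
      simpa using this
    rw [this, sub_self, abs_zero] at h1
    linarith
  have hcard : S.card = Z.card := Finset.card_image_of_injOn hinj
  set V : ℝ := Real.sqrt (W / (2 * A)) with hV
  have hV0 : 0 < V := Real.sqrt_pos.2 (by positivity)
  have hV2 : V ^ 2 = W / (2 * A) := Real.sq_sqrt (by positivity)
  set T : ℝ := T₁ + 2 * A with hT
  have h1 : ∀ s ∈ S, 0 ≤ s.re ∧ s.re ≤ 1 / 3 := by
    intro s hs
    rw [hS, Finset.mem_image] at hs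
    obtain ⟨ρ, -, rfl⟩ := hs
    simp
  have h2 : ∀ s ∈ S, ∀ s' ∈ S, s ≠ s' → Real.log X ≤ |s.im - s'.im| ∧ |s.im - s'.im| ≤ T := by
    intro s hs s' hs' hne
    rw [hS, Finset.mem_image] at hs hs'
    obtain ⟨ρ, hρ, rfl⟩ := hs
    obtain ⟨ρ', hρ', rfl⟩ := hs'
    have hne' : ρ ≠ ρ' := fun e ↦ hne (by rw [e])
    have h := hsp ρ hρ ρ' hρ' hne'
    simp only [Complex.mul_im, Complex.ofReal_re, Complex.I_im, Complex.ofReal_im, Complex.I_re,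
      mul_zero, mul_one, add_zero]
    exact ⟨hAX.trans h.1, h.2⟩
  have h3 : ∀ s ∈ S, V ≤ ‖∑ m ∈ Finset.Icc 1 X, a m * (m : ℂ) ^ (-s)‖ := by
    intro s hs
    rw [hS, Finset.mem_image] at hs
    obtain ⟨ρ, hρ, rfl⟩ := hs
    have e : mollifier X (1 / 2 + ((tstar ρ : ℝ) : ℂ) * I) =
        ∑ m ∈ Finset.Icc 1 X, a m * (m : ℂ) ^ (-(((tstar ρ : ℝ) : ℂ) * I)) :=
      ZeroDensity.mollifier_half_line X (tstar ρ)
    rw [← e]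
    have h := hval ρ hρ
    rw [← hV2] at h
    exact le_of_pow_le_pow_left₀ two_ne_zero (norm_nonneg _) h
  have hLV := hC X a T V S hX hT₁A hV0 h1 h2 h3
  rw [hcard] at hLV
  have hG : ∑ m ∈ Finset.Icc 1 X, ‖a m‖ ^ 2 ≤ 1 + Real.log X := sum_norm_sq_moebius_rpow_le X
  have hG0 : 0 ≤ ∑ m ∈ Finset.Icc 1 X, ‖a m‖ ^ 2 := Finset.sum_nonneg fun m _ ↦ by positivity
  have hV2' : V⁻¹ ^ 2 = 2 * A / W := by rw [inv_pow, hV2, inv_div]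
  have hV6 : V⁻¹ ^ 6 = (2 * A / W) ^ 3 := by
    rw [show (6 : ℕ) = 2 * 3 by norm_num, pow_mul, hV2']
  rw [hV2', hV6] at hLV
  have hT0 : 0 ≤ T := by linarith
  have hAW : 0 ≤ 2 * A / W := by positivity
  have hL4 : 0 ≤ Real.log (X * T) ^ 4 := by positivity
  have hbody : (∑ m ∈ Finset.Icc 1 X, ‖a m‖ ^ 2) * X * (2 * A / W) +
      (∑ m ∈ Finset.Icc 1 X, ‖a m‖ ^ 2) ^ 3 * X * T * (2 * A / W) ^ 3 * Real.log (X * T) ^ 4 ≤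
      (1 + Real.log X) * X * (2 * A / W) +
        (1 + Real.log X) ^ 3 * X * T * (2 * A / W) ^ 3 * Real.log (X * T) ^ 4 := by
    gcongr
  have hbody0 : 0 ≤ (∑ m ∈ Finset.Icc 1 X, ‖a m‖ ^ 2) * X * (2 * A / W) +
      (∑ m ∈ Finset.Icc 1 X, ‖a m‖ ^ 2) ^ 3 * X * T * (2 * A / W) ^ 3 * Real.log (X * T) ^ 4 := by
    positivity
  calc (Z.card : ℝ) ≤ _ := hLV
    _ ≤ max C 0 * ((∑ m ∈ Finset.Icc 1 X, ‖a m‖ ^ 2) * X * (2 * A / W) +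
        (∑ m ∈ Finset.Icc 1 X, ‖a m‖ ^ 2) ^ 3 * X * T * (2 * A / W) ^ 3 * Real.log (X * T) ^ 4) :=
        mul_le_mul_of_nonneg_right (le_max_left _ _) hbody0
    _ ≤ _ := by rw [hT]; exact mul_le_mul_of_nonneg_left (by rw [← hT]; exact hbody) (le_max_right _ _)


/-! ## §5. Bookkeeping: exponents, thinning, pigeonhole, coefficient blocks -/

/-- **The exponent identities behind (28.16)–(28.19).** For `3/4 ≤ σ < 1`, with `D = σ²+σ−1 > 0`,
`x₀ = (2σ−1)/2D`, `y₀ = (5σ−3)/2D`, `κ = (5σ−3)(1−σ)/D`: `y₀(2−2σ) = κ` (the term `Y^{2−2α}`),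
`1 + x₀(4−6σ) = κ` (the term `X^{4−6α}T`), `x₀ + 1 + 3(1−κ)/2 − 3y₀(2σ−1) = κ` (the term
`XTV⁻⁶` with `TU⁻⁴ = T^κ`, `UV = Y^{σ−1/2}`), `x₀ + (1−κ)/2 − y₀(2σ−1) ≤ κ` (the term `XV⁻²`),
and the ranges `1/4 ≤ x₀ ≤ 1`, `1 ≤ y₀ ≤ 2`, `0 < κ ≤ 3/5`. [cite: Huxley1972, Ch. 28, (28.16)–(28.19)] -/
theorem huxley_exponents {σ : ℝ} (h₀ : 3 / 4 ≤ σ) (h₁ : σ < 1) :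
    0 < σ ^ 2 + σ - 1 ∧
      (5 * σ - 3) / (2 * (σ ^ 2 + σ - 1)) * (2 - 2 * σ) = (5 * σ - 3) * (1 - σ) / (σ ^ 2 + σ - 1) ∧
      1 + (2 * σ - 1) / (2 * (σ ^ 2 + σ - 1)) * (4 - 6 * σ) = (5 * σ - 3) * (1 - σ) / (σ ^ 2 + σ - 1) ∧
      (2 * σ - 1) / (2 * (σ ^ 2 + σ - 1)) + 1 + 3 * (1 - (5 * σ - 3) * (1 - σ) / (σ ^ 2 + σ - 1)) / 2 -
          3 * ((5 * σ - 3) / (2 * (σ ^ 2 + σ - 1))) * (2 * σ - 1) =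
        (5 * σ - 3) * (1 - σ) / (σ ^ 2 + σ - 1) ∧
      (2 * σ - 1) / (2 * (σ ^ 2 + σ - 1)) + (1 - (5 * σ - 3) * (1 - σ) / (σ ^ 2 + σ - 1)) / 2 -
          (5 * σ - 3) / (2 * (σ ^ 2 + σ - 1)) * (2 * σ - 1) ≤
        (5 * σ - 3) * (1 - σ) / (σ ^ 2 + σ - 1) ∧
      (1 / 4 ≤ (2 * σ - 1) / (2 * (σ ^ 2 + σ - 1)) ∧ (2 * σ - 1) / (2 * (σ ^ 2 + σ - 1)) ≤ 1) ∧
      (1 ≤ (5 * σ - 3) / (2 * (σ ^ 2 + σ - 1)) ∧ (5 * σ - 3) / (2 * (σ ^ 2 + σ - 1)) ≤ 2) ∧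
      (0 < (5 * σ - 3) * (1 - σ) / (σ ^ 2 + σ - 1) ∧
        (5 * σ - 3) * (1 - σ) / (σ ^ 2 + σ - 1) ≤ 3 / 5) := by
  have hD : 0 < σ ^ 2 + σ - 1 := by nlinarith
  set D := σ ^ 2 + σ - 1 with hDdef
  have hD' : D ≠ 0 := hD.ne'
  set x₀ := (2 * σ - 1) / (2 * D) with hx
  set y₀ := (5 * σ - 3) / (2 * D) with hy
  set κ := (5 * σ - 3) * (1 - σ) / D with hk
  -- cleared forms
  have hx' : x₀ * (2 * D) = 2 * σ - 1 := by rw [hx]; field_simp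
  have hy' : y₀ * (2 * D) = 5 * σ - 3 := by rw [hy]; field_simp
  have hk' : κ * D = (5 * σ - 3) * (1 - σ) := by rw [hk]; field_simp
  refine ⟨hD, ?_, ?_, ?_, ?_, ⟨?_, ?_⟩, ⟨?_, ?_⟩, ⟨?_, ?_⟩⟩
  · apply mul_right_cancel₀ hD'
    rw [hk']; nlinarith [hy']
  · apply mul_right_cancel₀ hD'
    rw [hk']; nlinarith [hx']
  · apply mul_right_cancel₀ hD'
    rw [hk']; nlinarith [hx', hy', hk']
  · rw [← sub_nonneg]
    have e : (κ - (x₀ + (1 - κ) / 2 - y₀ * (2 * σ - 1))) * (2 * D) =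
        2 * (3 * σ - 2) * (1 - σ) := by nlinarith [hx', hy', hk']
    have h2 : 0 ≤ (κ - (x₀ + (1 - κ) / 2 - y₀ * (2 * σ - 1))) * (2 * D) := by
      rw [e]; nlinarith
    exact nonneg_of_mul_nonneg_left h2 (by positivity)
  · rw [hx, le_div_iff₀ (by positivity), hDdef]; nlinarith
  · rw [hx, div_le_iff₀ (by positivity), hDdef]; nlinarith
  · rw [hy, le_div_iff₀ (by positivity), hDdef]; nlinarith
  · rw [hy, div_le_iff₀ (by positivity), hDdef]; nlinarith
  · rw [hk]; exact div_pos (by nlinarith) hD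
  · rw [hk, div_le_iff₀ hD, hDdef]
    nlinarith [mul_nonneg (sub_nonneg.2 h₀) (by linarith : (0 : ℝ) ≤ 3 * σ - 1)]

/-- **Pigeonhole over blocks**: if `‖∑_{i<J} f i‖ > 1/3` then some block has `‖f i‖ > 1/(3J)`.
[folklore] -/
theorem exists_block_large {J : ℕ} {f : ℕ → ℂ} (h : 1 / 3 < ‖∑ i ∈ Finset.range J, f i‖) :
    ∃ i ∈ Finset.range J, 1 / (3 * (J : ℝ)) < ‖f i‖ := by
  by_contra hcon
  simp only [not_exists, not_and, not_lt] at hcon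
  have h1 : ‖∑ i ∈ Finset.range J, f i‖ ≤ ∑ i ∈ Finset.range J, 1 / (3 * (J : ℝ)) :=
    (norm_sum_le _ _).trans (Finset.sum_le_sum hcon)
  rw [Finset.sum_const, Finset.card_range, nsmul_eq_mul] at h1
  rcases Nat.eq_zero_or_pos J with hJ | hJ
  · subst hJ; simp at h
    linarith
  · have hJ' : (0 : ℝ) < J := by exact_mod_cast hJ
    have : (J : ℝ) * (1 / (3 * J)) = 1 / 3 := by field_simp
    linarith

/-- **Thinning a `1`-spaced set.** Let `Z` be a finite set of points with nonnegative ordinates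
pairwise `≥ 1` apart, and `k ≥ 1`. If every subset of `Z` whose ordinates are pairwise `≥ k − 1`
apart has at most `B` elements, then `|Z| ≤ k B` (split `Z` by `⌊Im ρ⌋ mod k`; Huxley p. 117: "We pick
representatives … in such a way that their imaginary parts differ by at least `2l` … but the
representatives are in number `≫ l⁻²` times the zeros"). [cite: Huxley1972, Ch. 28, (28.1)] -/
theorem card_le_of_thinning (Z : Finset ℂ) {k : ℕ} (hk : 1 ≤ k) {B : ℝ}
    (hpos : ∀ ρ ∈ Z, 0 ≤ ρ.im) (hsep : ∀ ρ ∈ Z, ∀ ρ' ∈ Z, ρ ≠ ρ' → 1 ≤ |ρ.im - ρ'.im|)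
    (hB : ∀ Z' ⊆ Z, (∀ ρ ∈ Z', ∀ ρ' ∈ Z', ρ ≠ ρ' → (k : ℝ) - 1 ≤ |ρ.im - ρ'.im|) → (Z'.card : ℝ) ≤ B) :
    (Z.card : ℝ) ≤ k * B := by
  classical
  set cls : ℂ → ℕ := fun ρ ↦ ⌊ρ.im⌋₊ % k with hcls
  have hcover : Z = (Finset.range k).biUnion (fun r ↦ Z.filter (fun ρ ↦ cls ρ = r)) := by
    ext ρ
    simp only [Finset.mem_biUnion, Finset.mem_range, Finset.mem_filter]
    constructor
    · intro h; exact ⟨cls ρ, Nat.mod_lt _ (by omega), h, rfl⟩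
    · rintro ⟨r, -, h, -⟩; exact h
  have hclass : ∀ r ∈ Finset.range k, ((Z.filter (fun ρ ↦ cls ρ = r)).card : ℝ) ≤ B := by
    intro r _
    refine hB _ (Finset.filter_subset _ _) fun ρ hρ ρ' hρ' hne ↦ ?_
    rw [Finset.mem_filter] at hρ hρ'
    have h1 := hsep ρ hρ.1 ρ' hρ'.1 hne
    -- the integer parts differ and are congruent mod `k`
    have hfl : ⌊ρ.im⌋₊ ≠ ⌊ρ'.im⌋₊ := by
      intro he
      have hx0 := hpos ρ hρ.1
      have hy0 := hpos ρ' hρ'.1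
      have hx1 := Nat.floor_le hx0
      have hx2 := Nat.lt_floor_add_one ρ.im
      have hy1 := Nat.floor_le hy0
      have hy2 := Nat.lt_floor_add_one ρ'.im
      rw [he] at hx1 hx2
      have : |ρ.im - ρ'.im| < 1 := by rw [abs_lt]; constructor <;> linarith
      linarith
    have hmod : ⌊ρ.im⌋₊ % k = ⌊ρ'.im⌋₊ % k := by
      have e1 : cls ρ = r := hρ.2
      have e2 : cls ρ' = r := hρ'.2
      rw [hcls] at e1 e2
      simp only at e1 e2
      rw [e1, e2]
    -- hence `|⌊x⌋ - ⌊y⌋| ≥ k`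
    have hdiff : (k : ℤ) ≤ |((⌊ρ.im⌋₊ : ℕ) : ℤ) - ((⌊ρ'.im⌋₊ : ℕ) : ℤ)| := by
      have hdvd : (k : ℤ) ∣ ((⌊ρ.im⌋₊ : ℕ) : ℤ) - ((⌊ρ'.im⌋₊ : ℕ) : ℤ) := by
        have := Nat.ModEq.dvd hmod.symm
        simpa using Int.dvd_neg.2 this |>.neg_right |> fun h ↦ by simpa using h
      have hne0 : ((⌊ρ.im⌋₊ : ℕ) : ℤ) - ((⌊ρ'.im⌋₊ : ℕ) : ℤ) ≠ 0 := by
        intro h0; apply hfl; exact_mod_cast (sub_eq_zero.1 h0)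
      exact Int.le_of_dvd (abs_pos.2 hne0) ((dvd_abs _ _).2 hdvd)
    have hx0 := hpos ρ hρ.1
    have hy0 := hpos ρ' hρ'.1
    have hx1 := Nat.floor_le hx0
    have hx2 := Nat.lt_floor_add_one ρ.im
    have hy1 := Nat.floor_le hy0
    have hy2 := Nat.lt_floor_add_one ρ'.im
    have hdiff' : (k : ℝ) ≤ |((⌊ρ.im⌋₊ : ℝ)) - (⌊ρ'.im⌋₊ : ℝ)| := by
      have : ((k : ℤ) : ℝ) ≤ ((|((⌊ρ.im⌋₊ : ℕ) : ℤ) - ((⌊ρ'.im⌋₊ : ℕ) : ℤ)| : ℤ) : ℝ) := by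
        exact_mod_cast hdiff
      push_cast at this
      exact this
    have hk' : (1 : ℝ) ≤ k := by exact_mod_cast hk
    rcases le_total (⌊ρ.im⌋₊ : ℝ) (⌊ρ'.im⌋₊ : ℝ) with hle | hle
    · rw [abs_of_nonpos (by linarith)] at hdiff'
      rw [abs_sub_comm, abs_of_nonneg (by linarith)]
      linarith
    · rw [abs_of_nonneg (by linarith)] at hdiff'
      rw [abs_of_nonneg (by linarith)]
      linarith
  calc (Z.card : ℝ) = (((Finset.range k).biUnion (fun r ↦ Z.filter (fun ρ ↦ cls ρ = r))).card : ℝ) := by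
        rw [← hcover]
    _ ≤ ∑ r ∈ Finset.range k, ((Z.filter (fun ρ ↦ cls ρ = r)).card : ℝ) := by
        exact_mod_cast Finset.card_biUnion_le
    _ ≤ ∑ r ∈ Finset.range k, B := Finset.sum_le_sum hclass
    _ = k * B := by rw [Finset.sum_const, Finset.card_range, nsmul_eq_mul]

/-- **The coefficient sum of a block** (Huxley (28.14) without the exponential factor): if
`|c(n)| ≤ d(n) ≤ C_d n^η` (`η ≥ 0`) then `∑_{M<n≤2M} |c(n)|² n^{-2σ} ≤ C_d² (2M)^{2η} M^{1−2σ}`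
(`M ≥ 1`, `σ ≥ 0`). [cite: Huxley1972, Ch. 28, (28.14)] -/
theorem sum_block_coeff_le {c : ℕ → ℂ} (hc : ∀ n, ‖c n‖ ≤ (n.divisors.card : ℝ)) {C_d η : ℝ}
    (hη : 0 ≤ η) (hd : ∀ n : ℕ, (n.divisors.card : ℝ) ≤ C_d * (n : ℝ) ^ η) {σ : ℝ} (hσ : 0 ≤ σ)
    {M : ℕ} (hM : 1 ≤ M) :
    ∑ n ∈ Finset.Ioc M (2 * M), ‖c n‖ ^ 2 * (n : ℝ) ^ (-2 * σ) ≤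
      C_d ^ 2 * (2 * (M : ℝ)) ^ (2 * η) * (M : ℝ) ^ (1 - 2 * σ) := by
  have hM0 : (0 : ℝ) < M := by exact_mod_cast hM
  have hCd : 0 ≤ C_d := by
    have := (hc 1).trans (hd 1)
    simp at this
    linarith [norm_nonneg (c 1)]
  have hterm : ∀ n ∈ Finset.Ioc M (2 * M), ‖c n‖ ^ 2 * (n : ℝ) ^ (-2 * σ) ≤
      C_d ^ 2 * (2 * (M : ℝ)) ^ (2 * η) * (M : ℝ) ^ (-2 * σ) := by
    intro n hn
    simp only [Finset.mem_Ioc] at hn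
    have hn0 : (0 : ℝ) < n := by exact_mod_cast (by omega : 0 < n)
    have hMn : (M : ℝ) ≤ n := by exact_mod_cast hn.1.le
    have hn2M : (n : ℝ) ≤ 2 * M := by exact_mod_cast hn.2
    have h1 : ‖c n‖ ≤ C_d * (n : ℝ) ^ η := (hc n).trans (hd n)
    have h2 : ‖c n‖ ^ 2 ≤ C_d ^ 2 * (2 * (M : ℝ)) ^ (2 * η) := by
      calc ‖c n‖ ^ 2 ≤ (C_d * (n : ℝ) ^ η) ^ 2 := pow_le_pow_left₀ (norm_nonneg _) h1 2
        _ = C_d ^ 2 * ((n : ℝ) ^ η) ^ 2 := by ring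
        _ ≤ C_d ^ 2 * ((2 * (M : ℝ)) ^ η) ^ 2 := by
            gcongr
        _ = C_d ^ 2 * (2 * (M : ℝ)) ^ (2 * η) := by
            rw [← Real.rpow_natCast ((2 * (M : ℝ)) ^ η), ← Real.rpow_mul (by positivity)]
            congr 1; push_cast; ring
    have h3 : (n : ℝ) ^ (-2 * σ) ≤ (M : ℝ) ^ (-2 * σ) :=
      Real.rpow_le_rpow_of_nonpos hM0 hMn (by nlinarith)
    exact mul_le_mul h2 h3 (Real.rpow_nonneg hn0.le _) (by positivity)
  calc ∑ n ∈ Finset.Ioc M (2 * M), ‖c n‖ ^ 2 * (n : ℝ) ^ (-2 * σ)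
      ≤ ∑ n ∈ Finset.Ioc M (2 * M), C_d ^ 2 * (2 * (M : ℝ)) ^ (2 * η) * (M : ℝ) ^ (-2 * σ) :=
        Finset.sum_le_sum hterm
    _ = M * (C_d ^ 2 * (2 * (M : ℝ)) ^ (2 * η) * (M : ℝ) ^ (-2 * σ)) := by
        rw [Finset.sum_const, nsmul_eq_mul, Nat.card_Ioc]
        congr 1
        rw [show 2 * M - M = M by omega]
    _ = C_d ^ 2 * (2 * (M : ℝ)) ^ (2 * η) * (M : ℝ) ^ (1 - 2 * σ) := by
        rw [show (1 : ℝ) - 2 * σ = 1 + (-2 * σ) by ring, Real.rpow_add hM0, Real.rpow_one]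
        ring


/-! ## §6. The class (i) count (Huxley (28.13)–(28.16)) -/

/-- **The class (i) zeros** (Huxley (28.13)–(28.16)). Let `σ ≥ 3/4`, `T ≥ 1`, `X ≥ 1`,
`1 ≤ N₀ < 2^J`, `|c(n)| ≤ d(n) ≤ C_d n^η`, and let `Z` be a finite set of points `ρ = β + iγ`,
`σ ≤ β < 1`, with ordinates pairwise between `log 2N₀` and `T` apart. The number of `ρ ∈ Z` with
`|∑_{X<n≤N₀} c(n) n^{-ρ}| > 1/3` is at most
`J · C_b (18 C_d² J² (2N₀)^{2η} N₀^{2−2σ} + 1458 C_d⁶ J⁶ T log⁴(2N₀T) (2N₀)^{6η} X^{4−6σ})`: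
split `(X, N₀]` into the dyadic blocks `(X2^i, X2^{i+1}]`, `i < J`; a class (i) zero has a block
with `|∑_{block}| > 1/(3J)` (`exists_block_large`); each block is counted by the large-values
theorem (`exists_block_largeValues_const`) with `G ≤ C_d² (2M)^{2η} M^{1−2σ}`
(`sum_block_coeff_le`), and
`M^{2−2σ} ≤ N₀^{2−2σ}`, `M^{4−6σ} ≤ X^{4−6σ}` (`4 − 6σ ≤ 0`). [cite: Huxley1972, Ch. 28, (28.13)–(28.16)] -/
theorem classOne_card_le {C_b : ℝ} (hCb0 : 0 ≤ C_b)
    (hCb : ∀ (b : ℕ → ℂ) (M : ℕ) (σ T V : ℝ) (Z : Finset ℂ), 1 ≤ M → 1 ≤ T → 0 < V →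
    (∀ ρ ∈ Z, σ ≤ ρ.re ∧ ρ.re ≤ σ + 1 / 3) →
    (∀ ρ ∈ Z, ∀ ρ' ∈ Z, ρ ≠ ρ' → Real.log (2 * M) ≤ |ρ.im - ρ'.im| ∧ |ρ.im - ρ'.im| ≤ T) →
    (∀ ρ ∈ Z, V ≤ ‖∑ n ∈ Finset.Ioc M (2 * M), b n * (n : ℂ) ^ (-ρ)‖) →
    (Z.card : ℝ) ≤ C_b *
      ((∑ n ∈ Finset.Ioc M (2 * M), ‖b n‖ ^ 2 * (n : ℝ) ^ (-2 * σ)) * (2 * M) * V⁻¹ ^ 2 +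
        (∑ n ∈ Finset.Ioc M (2 * M), ‖b n‖ ^ 2 * (n : ℝ) ^ (-2 * σ)) ^ 3 * (2 * M) * T * V⁻¹ ^ 6 *
          Real.log (2 * M * T) ^ 4))
    {C_d η : ℝ} (hη : 0 ≤ η) (hd : ∀ n : ℕ, (n.divisors.card : ℝ) ≤ C_d * (n : ℝ) ^ η)
    {c : ℕ → ℂ} (hc : ∀ n, ‖c n‖ ≤ (n.divisors.card : ℝ))
    {σ T : ℝ} (hσ : 3 / 4 ≤ σ) (hσ1 : σ ≤ 1) (hT : 1 ≤ T) {X N₀ J : ℕ} (hX : 1 ≤ X) (hN₀ : 1 ≤ N₀)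
    (hJ : N₀ < 2 ^ J) (Z : Finset ℂ) (hre : ∀ ρ ∈ Z, σ ≤ ρ.re ∧ ρ.re < 1)
    (hsep : ∀ ρ ∈ Z, ∀ ρ' ∈ Z, ρ ≠ ρ' → Real.log (2 * N₀) ≤ |ρ.im - ρ'.im| ∧ |ρ.im - ρ'.im| ≤ T) :
    ((Z.filter (fun ρ ↦ 1 / 3 < ‖∑ n ∈ Finset.Ioc X N₀, c n * (n : ℂ) ^ (-ρ)‖)).card : ℝ) ≤
      J * (C_b * (18 * C_d ^ 2 * (J : ℝ) ^ 2 * (2 * (N₀ : ℝ)) ^ (2 * η) * (N₀ : ℝ) ^ (2 - 2 * σ) +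
        1458 * C_d ^ 6 * (J : ℝ) ^ 6 * T * Real.log (2 * N₀ * T) ^ 4 * (2 * (N₀ : ℝ)) ^ (6 * η) *
          (X : ℝ) ^ (4 - 6 * σ))) := by
  classical
  -- `J ≥ 1`
  have hJ1 : 1 ≤ J := by
    rcases Nat.eq_zero_or_pos J with h | h
    · subst h; simp at hJ; omega
    · exact h
  have hJ0 : (0 : ℝ) < J := by exact_mod_cast hJ1
  have hN₀0 : (0 : ℝ) < N₀ := by exact_mod_cast hN₀
  have hX0 : (0 : ℝ) < X := by exact_mod_cast hX
  -- the truncated coefficients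
  set c' : ℕ → ℂ := fun n ↦ if n ≤ N₀ then c n else 0 with hc'def
  have hc' : ∀ n, ‖c' n‖ ≤ (n.divisors.card : ℝ) := by
    intro n; rw [hc'def]; dsimp only
    split_ifs
    · exact hc n
    · simp
  -- the blocks
  set B : ℕ → ℂ → ℂ := fun i ρ ↦ ∑ n ∈ Finset.Ioc (X * 2 ^ i) (X * 2 ^ (i + 1)), c' n * (n : ℂ) ^ (-ρ)
    with hBdef
  have hNXJ : N₀ ≤ X * 2 ^ J := by
    calc N₀ ≤ 2 ^ J := hJ.le
      _ = 1 * 2 ^ J := (one_mul _).symm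
      _ ≤ X * 2 ^ J := Nat.mul_le_mul_right _ hX
  have hsplit : ∀ ρ : ℂ, ∑ n ∈ Finset.Ioc X N₀, c n * (n : ℂ) ^ (-ρ) =
      ∑ i ∈ Finset.range J, B i ρ := by
    intro ρ
    have h1 : ∑ n ∈ Finset.Ioc X N₀, c n * (n : ℂ) ^ (-ρ) =
        ∑ n ∈ Finset.Ioc X (X * 2 ^ J), c' n * (n : ℂ) ^ (-ρ) := by
      have hsub : Finset.Ioc X N₀ ⊆ Finset.Ioc X (X * 2 ^ J) := fun n hn ↦ by
        simp only [Finset.mem_Ioc] at hn ⊢; exact ⟨hn.1, hn.2.trans hNXJ⟩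
      rw [← Finset.sum_subset hsub]
      · refine Finset.sum_congr rfl fun n hn ↦ ?_
        simp only [Finset.mem_Ioc] at hn
        rw [hc'def]; dsimp only; rw [if_pos hn.2]
      · intro n _ hn'
        simp only [Finset.mem_Ioc, not_and, not_le] at hn'
        rw [hc'def]; dsimp only
        rw [if_neg (by
          intro hle
          simp only [Finset.mem_Ioc] at *
          omega), zero_mul]
    rw [h1, ZeroDensity.sum_Ioc_mul_two_pow]
  set V : ℝ := 1 / (3 * (J : ℝ)) with hV
  have hV0 : 0 < V := by positivity
  set Zi : ℕ → Finset ℂ := fun i ↦ Z.filter (fun ρ ↦ V ≤ ‖B i ρ‖) with hZi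
  have hcover : Z.filter (fun ρ ↦ 1 / 3 < ‖∑ n ∈ Finset.Ioc X N₀, c n * (n : ℂ) ^ (-ρ)‖) ⊆
      (Finset.range J).biUnion Zi := by
    intro ρ hρ
    rw [Finset.mem_filter] at hρ
    rw [hsplit ρ] at hρ
    obtain ⟨i, hi, hlarge⟩ := exists_block_large hρ.2
    rw [Finset.mem_biUnion]
    exact ⟨i, hi, by rw [hZi, Finset.mem_filter]; exact ⟨hρ.1, hlarge.le⟩⟩
  -- the bound for one block
  set R : ℝ := C_b * (18 * C_d ^ 2 * (J : ℝ) ^ 2 * (2 * (N₀ : ℝ)) ^ (2 * η) * (N₀ : ℝ) ^ (2 - 2 * σ) +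
      1458 * C_d ^ 6 * (J : ℝ) ^ 6 * T * Real.log (2 * N₀ * T) ^ 4 * (2 * (N₀ : ℝ)) ^ (6 * η) *
        (X : ℝ) ^ (4 - 6 * σ)) with hR
  have hR0 : 0 ≤ R := by rw [hR]; positivity
  have hblock : ∀ i ∈ Finset.range J, ((Zi i).card : ℝ) ≤ R := by
    intro i _
    set M : ℕ := X * 2 ^ i with hM
    have hM1 : 1 ≤ M := by rw [hM]; exact Nat.one_le_iff_ne_zero.2 (by positivity)
    have hM0 : (0 : ℝ) < M := by exact_mod_cast hM1
    have hblk : X * 2 ^ (i + 1) = 2 * M := by rw [hM]; ring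
    by_cases hNM : N₀ ≤ M
    · -- empty block
      have hempty : Zi i = ∅ := by
        rw [Finset.eq_empty_iff_forall_notMem]
        intro ρ hρ
        rw [hZi, Finset.mem_filter] at hρ
        have hB0 : B i ρ = 0 := by
          rw [hBdef]; dsimp only
          refine Finset.sum_eq_zero fun n hn ↦ ?_
          simp only [Finset.mem_Ioc] at hn
          rw [hc'def]; dsimp only
          rw [if_neg (by omega), zero_mul]
        rw [hB0, norm_zero] at hρ
        linarith [hρ.2]
      rw [hempty, Finset.card_empty, Nat.cast_zero]; exact hR0
    · rw [not_le] at hNM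
      -- the large-values theorem on the block `(M, 2M]`
      have hre' : ∀ ρ ∈ Zi i, σ ≤ ρ.re ∧ ρ.re ≤ σ + 1 / 3 := by
        intro ρ hρ
        rw [hZi, Finset.mem_filter] at hρ
        have := hre ρ hρ.1
        exact ⟨this.1, by linarith [this.2]⟩
      have hsep' : ∀ ρ ∈ Zi i, ∀ ρ' ∈ Zi i, ρ ≠ ρ' →
          Real.log (2 * M) ≤ |ρ.im - ρ'.im| ∧ |ρ.im - ρ'.im| ≤ T := by
        intro ρ hρ ρ' hρ' hne
        rw [hZi, Finset.mem_filter] at hρ hρ'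
        have h := hsep ρ hρ.1 ρ' hρ'.1 hne
        have hlog : Real.log (2 * M) ≤ Real.log (2 * N₀) :=
          Real.log_le_log (by positivity) (by exact_mod_cast (by omega : 2 * M ≤ 2 * N₀))
        exact ⟨hlog.trans h.1, h.2⟩
      have hlarge' : ∀ ρ ∈ Zi i, V ≤ ‖∑ n ∈ Finset.Ioc M (2 * M), c' n * (n : ℂ) ^ (-ρ)‖ := by
        intro ρ hρ
        rw [hZi, Finset.mem_filter] at hρ
        have := hρ.2
        rw [hBdef] at this; dsimp only at this
        rwa [hblk] at this
      have hLV := hCb c' M σ T V (Zi i) hM1 hT hV0 hre' hsep' hlarge'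
      -- the coefficient sum
      set G : ℝ := ∑ n ∈ Finset.Ioc M (2 * M), ‖c' n‖ ^ 2 * (n : ℝ) ^ (-2 * σ) with hG
      have hG0 : 0 ≤ G := Finset.sum_nonneg fun n _ ↦ by positivity
      have hGle : G ≤ C_d ^ 2 * (2 * (M : ℝ)) ^ (2 * η) * (M : ℝ) ^ (1 - 2 * σ) :=
        sum_block_coeff_le hc' hη hd (by linarith) hM1
      -- sizes
      have h2M : (2 * (M : ℝ)) ≤ 2 * N₀ := by exact_mod_cast (by omega : 2 * M ≤ 2 * N₀)
      have hMN : (M : ℝ) ≤ N₀ := by exact_mod_cast hNM.le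
      have hXM : (X : ℝ) ≤ M := by
        rw [hM]; push_cast
        exact le_mul_of_one_le_right hX0.le (one_le_pow₀ (by norm_num))
      have hVinv : V⁻¹ = 3 * J := by rw [hV, one_div, inv_inv]
      have hM1r : (1 : ℝ) ≤ M := by exact_mod_cast hM1
      have hMT : (1 : ℝ) ≤ M * T := one_le_mul_of_one_le_of_one_le hM1r hT
      have hlogle : Real.log (2 * M * T) ^ 4 ≤ Real.log (2 * N₀ * T) ^ 4 := by
        have h0 : 0 ≤ Real.log (2 * M * T) := Real.log_nonneg (by linarith)
        refine pow_le_pow_left₀ h0 (Real.log_le_log (by positivity) ?_) 4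
        have hT0 : 0 ≤ T := by linarith
        nlinarith [mul_le_mul_of_nonneg_right hMN hT0]
      have hr1 : (2 * (M : ℝ)) ^ (2 * η) ≤ (2 * (N₀ : ℝ)) ^ (2 * η) :=
        Real.rpow_le_rpow (by positivity) h2M (by positivity)
      have hr2 : (M : ℝ) ^ (2 - 2 * σ) ≤ (N₀ : ℝ) ^ (2 - 2 * σ) :=
        Real.rpow_le_rpow hM0.le hMN (by linarith)
      have hr3 : (2 * (M : ℝ)) ^ (6 * η) ≤ (2 * (N₀ : ℝ)) ^ (6 * η) :=
        Real.rpow_le_rpow (by positivity) h2M (by positivity)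
      -- first term
      have hA : G * (2 * M) * V⁻¹ ^ 2 ≤
          18 * C_d ^ 2 * (J : ℝ) ^ 2 * (2 * (N₀ : ℝ)) ^ (2 * η) * (N₀ : ℝ) ^ (2 - 2 * σ) := by
        have e1 : (M : ℝ) ^ (1 - 2 * σ) * M = (M : ℝ) ^ (2 - 2 * σ) := by
          rw [show (2 : ℝ) - 2 * σ = (1 - 2 * σ) + 1 by ring, Real.rpow_add hM0, Real.rpow_one]
        calc G * (2 * M) * V⁻¹ ^ 2
            ≤ (C_d ^ 2 * (2 * (M : ℝ)) ^ (2 * η) * (M : ℝ) ^ (1 - 2 * σ)) * (2 * M) * V⁻¹ ^ 2 := by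
              gcongr
          _ = 18 * C_d ^ 2 * (J : ℝ) ^ 2 * (2 * (M : ℝ)) ^ (2 * η) * ((M : ℝ) ^ (1 - 2 * σ) * M) := by
              rw [hVinv]; ring
          _ = 18 * C_d ^ 2 * (J : ℝ) ^ 2 * (2 * (M : ℝ)) ^ (2 * η) * (M : ℝ) ^ (2 - 2 * σ) := by rw [e1]
          _ ≤ 18 * C_d ^ 2 * (J : ℝ) ^ 2 * (2 * (N₀ : ℝ)) ^ (2 * η) * (N₀ : ℝ) ^ (2 - 2 * σ) :=
              mul_le_mul (mul_le_mul_of_nonneg_left hr1 (by positivity)) hr2 (by positivity)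
                (by positivity)
      -- second term
      have hB : G ^ 3 * (2 * M) * T * V⁻¹ ^ 6 * Real.log (2 * M * T) ^ 4 ≤
          1458 * C_d ^ 6 * (J : ℝ) ^ 6 * T * Real.log (2 * N₀ * T) ^ 4 * (2 * (N₀ : ℝ)) ^ (6 * η) *
            (X : ℝ) ^ (4 - 6 * σ) := by
        have e3 : ((M : ℝ) ^ (1 - 2 * σ)) ^ 3 * M = (M : ℝ) ^ (4 - 6 * σ) := by
          rw [← Real.rpow_natCast ((M : ℝ) ^ (1 - 2 * σ)), ← Real.rpow_mul hM0.le,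
            show (4 : ℝ) - 6 * σ = (1 - 2 * σ) * ((3 : ℕ) : ℝ) + 1 by push_cast; ring,
            Real.rpow_add hM0, Real.rpow_one]
        have e2 : ((2 * (M : ℝ)) ^ (2 * η)) ^ 3 = (2 * (M : ℝ)) ^ (6 * η) := by
          rw [← Real.rpow_natCast ((2 * (M : ℝ)) ^ (2 * η)), ← Real.rpow_mul (by positivity)]
          congr 1; push_cast; ring
        have hMX : (M : ℝ) ^ (4 - 6 * σ) ≤ (X : ℝ) ^ (4 - 6 * σ) :=
          Real.rpow_le_rpow_of_nonpos hX0 hXM (by linarith)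
        calc G ^ 3 * (2 * M) * T * V⁻¹ ^ 6 * Real.log (2 * M * T) ^ 4
            ≤ (C_d ^ 2 * (2 * (M : ℝ)) ^ (2 * η) * (M : ℝ) ^ (1 - 2 * σ)) ^ 3 * (2 * M) * T * V⁻¹ ^ 6 *
                Real.log (2 * N₀ * T) ^ 4 :=
              mul_le_mul (by gcongr) hlogle (by positivity) (by positivity)
          _ = 1458 * C_d ^ 6 * (J : ℝ) ^ 6 * T * Real.log (2 * N₀ * T) ^ 4 *
                ((2 * (M : ℝ)) ^ (2 * η)) ^ 3 * (((M : ℝ) ^ (1 - 2 * σ)) ^ 3 * M) := by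
              rw [hVinv]; ring
          _ = 1458 * C_d ^ 6 * (J : ℝ) ^ 6 * T * Real.log (2 * N₀ * T) ^ 4 *
                (2 * (M : ℝ)) ^ (6 * η) * (M : ℝ) ^ (4 - 6 * σ) := by rw [e3, e2]
          _ ≤ 1458 * C_d ^ 6 * (J : ℝ) ^ 6 * T * Real.log (2 * N₀ * T) ^ 4 *
                (2 * (N₀ : ℝ)) ^ (6 * η) * (X : ℝ) ^ (4 - 6 * σ) :=
              mul_le_mul (mul_le_mul_of_nonneg_left hr3 (by positivity)) hMX (by positivity)
                (by positivity)
      calc ((Zi i).card : ℝ) ≤ C_b * (G * (2 * M) * V⁻¹ ^ 2 + G ^ 3 * (2 * M) * T * V⁻¹ ^ 6 *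
            Real.log (2 * M * T) ^ 4) := hLV
        _ ≤ R := by rw [hR]; gcongr
  -- sum over the blocks
  calc ((Z.filter (fun ρ ↦ 1 / 3 < ‖∑ n ∈ Finset.Ioc X N₀, c n * (n : ℂ) ^ (-ρ)‖)).card : ℝ)
      ≤ (((Finset.range J).biUnion Zi).card : ℝ) := by exact_mod_cast Finset.card_le_card hcover
    _ ≤ ∑ i ∈ Finset.range J, ((Zi i).card : ℝ) := by exact_mod_cast Finset.card_biUnion_le
    _ ≤ ∑ i ∈ Finset.range J, R := Finset.sum_le_sum hblock
    _ = J * R := by rw [Finset.sum_const, Finset.card_range, nsmul_eq_mul]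


/-! ## §7. All zeros of a well-separated set: the raw count -/

/-- **The Cauchy–Schwarz split of the class (ii) condition**: if `∫_{-A}^{A} |f g| ≥ W > 0` then,
for any `λ > 0`, `∫_{-A}^{A} |f|² ≥ λW` or `∫_{-A}^{A} |g|² ≥ W/λ`. [folklore] -/
theorem classTwo_split {f g : ℝ → ℂ} (hf : Continuous f) (hg : Continuous g) {A W lam : ℝ}
    (hA : 0 ≤ A) (hW : 0 < W) (hl : 0 < lam)
    (h : W ≤ ∫ y in (-A)..A, ‖f y * g y‖) :
    lam * W ≤ ∫ y in (-A)..A, ‖f y‖ ^ 2 ∨ W / lam ≤ ∫ y in (-A)..A, ‖g y‖ ^ 2 := by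
  by_contra hcon
  simp only [not_or, not_le] at hcon
  obtain ⟨hP, hQ⟩ := hcon
  have hCS := ZeroDensity.sq_integral_mul_le (a := -A) (b := A) (by linarith) hf.norm hg.norm
  have hP0 : 0 ≤ ∫ y in (-A)..A, ‖f y‖ ^ 2 :=
    intervalIntegral.integral_nonneg (by linarith) fun y _ ↦ by positivity
  have hWl : 0 < W / lam := div_pos hW hl
  have h1 : W ^ 2 ≤ (∫ y in (-A)..A, ‖f y‖ ^ 2) * ∫ y in (-A)..A, ‖g y‖ ^ 2 := by
    calc W ^ 2 ≤ (∫ y in (-A)..A, ‖f y * g y‖) ^ 2 := pow_le_pow_left₀ hW.le h 2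
      _ = (∫ y in (-A)..A, ‖f y‖ * ‖g y‖) ^ 2 := by
          congr 1; exact intervalIntegral.integral_congr fun y _ ↦ norm_mul _ _
      _ ≤ _ := hCS
  have h2 : (∫ y in (-A)..A, ‖f y‖ ^ 2) * (∫ y in (-A)..A, ‖g y‖ ^ 2) < W ^ 2 := by
    calc (∫ y in (-A)..A, ‖f y‖ ^ 2) * (∫ y in (-A)..A, ‖g y‖ ^ 2)
        ≤ (∫ y in (-A)..A, ‖f y‖ ^ 2) * (W / lam) := mul_le_mul_of_nonneg_left hQ.le hP0
      _ < (lam * W) * (W / lam) := mul_lt_mul_of_pos_right hP hWl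
      _ = W ^ 2 := by field_simp
  linarith

/-- `log 200 ≤ 6`. [folklore] -/
theorem log_two_hundred_le : Real.log 200 ≤ 6 := by
  rw [Real.log_le_iff_le_exp (by norm_num)]
  have h := Real.exp_one_gt_d9
  have h6 : (2.7182818283 : ℝ) ^ 6 ≤ Real.exp 1 ^ 6 := pow_le_pow_left₀ (by norm_num) h.le 6
  have he : Real.exp 1 ^ 6 = Real.exp 6 := by rw [← Real.exp_nat_mul]; norm_num
  have h200 : (200 : ℝ) ≤ (2.7182818283 : ℝ) ^ 6 := by norm_num
  rw [he] at h6
  exact h200.trans h6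

/-- **The raw count of a well-separated set of zeros** (Huxley Ch. 28, (28.5)–(28.16), with the
class (ii a) zeros counted by the fourth moment of `ζ` on disjoint windows). Let `3/4 ≤ σ < 1`,
`U ≥ 1`, `T = 2U`, `l = log T`, `A = 100 l`, with `T ≥ 2³⁶/(σ−1/2) + 3` and `400 l ≤ T`; let
`2 ≤ X ≤ T²`, `10 ≤ Y ≤ T²`, `N₀ = ⌊100 l Y⌋ < 2^J`, `λ > 0`, `W₀ = 2⁻²⁰ (σ−1/2) Y^{σ−1/2}`. For a
finite set `Z` of zeros `ρ = β+iγ`, `β ≥ σ`, `U < γ ≤ 2U`, ordinates pairwise `≥ 3A` apart: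
`|Z| ≤ [class (i) bound of classOne_card_le] + 2A C₄ (3U)^{1+η}/(λW₀)² + C_c (…(2Aλ/W₀)…)`.
[cite: Huxley1972, Ch. 28, (28.5)–(28.16)] -/
theorem card_sep_le_raw {C_b : ℝ} (hCb0 : 0 ≤ C_b)
    (hCb : ∀ (b : ℕ → ℂ) (M : ℕ) (σ T V : ℝ) (Z : Finset ℂ), 1 ≤ M → 1 ≤ T → 0 < V →
    (∀ ρ ∈ Z, σ ≤ ρ.re ∧ ρ.re ≤ σ + 1 / 3) →
    (∀ ρ ∈ Z, ∀ ρ' ∈ Z, ρ ≠ ρ' → Real.log (2 * M) ≤ |ρ.im - ρ'.im| ∧ |ρ.im - ρ'.im| ≤ T) →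
    (∀ ρ ∈ Z, V ≤ ‖∑ n ∈ Finset.Ioc M (2 * M), b n * (n : ℂ) ^ (-ρ)‖) →
    (Z.card : ℝ) ≤ C_b *
      ((∑ n ∈ Finset.Ioc M (2 * M), ‖b n‖ ^ 2 * (n : ℝ) ^ (-2 * σ)) * (2 * M) * V⁻¹ ^ 2 +
        (∑ n ∈ Finset.Ioc M (2 * M), ‖b n‖ ^ 2 * (n : ℝ) ^ (-2 * σ)) ^ 3 * (2 * M) * T * V⁻¹ ^ 6 *
          Real.log (2 * M * T) ^ 4))
    {C_c : ℝ}
    (hCc : ∀ (X : ℕ) (A T₁ W : ℝ) (Z : Finset ℂ), 2 ≤ X → 0 < A →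
    Real.log X ≤ A → 0 ≤ T₁ → 1 ≤ T₁ + 2 * A → 0 < W →
    (∀ ρ ∈ Z, ∀ ρ' ∈ Z, ρ ≠ ρ' → 3 * A ≤ |ρ.im - ρ'.im| ∧ |ρ.im - ρ'.im| ≤ T₁) →
    (∀ ρ ∈ Z, W ≤ ∫ y in (-A)..A, ‖mollifier X (1 / 2 + ((ρ.im + y : ℝ) : ℂ) * I)‖ ^ 2) →
    (Z.card : ℝ) ≤ C_c * ((1 + Real.log X) * X * (2 * A / W) +
      (1 + Real.log X) ^ 3 * X * (T₁ + 2 * A) * (2 * A / W) ^ 3 * Real.log (X * (T₁ + 2 * A)) ^ 4))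
    {C_d η : ℝ} (hη : 0 ≤ η) (hd : ∀ n : ℕ, (n.divisors.card : ℝ) ≤ C_d * (n : ℝ) ^ η)
    {C₄ : ℝ} (h4 : ∀ T : ℝ, 1 ≤ T → ∫ t in (0 : ℝ)..T, ‖riemannZeta (1 / 2 + t * I)‖ ^ 4 ≤ C₄ * T ^ (1 + η))
    {σ : ℝ} (hσ : 3 / 4 ≤ σ) (hσ1 : σ < 1) {U : ℝ} (hU : 1 ≤ U)
    (hTδ : 2 ^ 36 / (σ - 1 / 2) + 3 ≤ 2 * U) (hlT : 400 * Real.log (2 * U) ≤ 2 * U)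
    {X : ℕ} (hX2 : 2 ≤ X) (hXT : (X : ℝ) ≤ (2 * U) ^ 2) {Y : ℝ} (hY : 10 ≤ Y) (hYT : Y ≤ (2 * U) ^ 2)
    {J : ℕ} (hJ : ⌊100 * Real.log (2 * U) * Y⌋₊ < 2 ^ J) {lam : ℝ} (hlam : 0 < lam)
    (Z : Finset ℂ) (hZ : ∀ ρ ∈ Z, riemannZeta ρ = 0 ∧ σ ≤ ρ.re ∧ U < ρ.im ∧ ρ.im ≤ 2 * U)
    (hsep : ∀ ρ ∈ Z, ∀ ρ' ∈ Z, ρ ≠ ρ' → 3 * (100 * Real.log (2 * U)) ≤ |ρ.im - ρ'.im|) :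
    (Z.card : ℝ) ≤
      J * (C_b * (18 * C_d ^ 2 * (J : ℝ) ^ 2 * (2 * (⌊100 * Real.log (2 * U) * Y⌋₊ : ℝ)) ^ (2 * η) *
            (⌊100 * Real.log (2 * U) * Y⌋₊ : ℝ) ^ (2 - 2 * σ) +
          1458 * C_d ^ 6 * (J : ℝ) ^ 6 * (2 * U) *
            Real.log (2 * (⌊100 * Real.log (2 * U) * Y⌋₊ : ℝ) * (2 * U)) ^ 4 *
            (2 * (⌊100 * Real.log (2 * U) * Y⌋₊ : ℝ)) ^ (6 * η) * (X : ℝ) ^ (4 - 6 * σ))) +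
      2 * (100 * Real.log (2 * U)) * (C₄ * (3 * U) ^ (1 + η)) /
          (lam * ((σ - 1 / 2) * Y ^ (σ - 1 / 2) / 2 ^ 20)) ^ 2 +
      C_c * ((1 + Real.log X) * X *
            (2 * (100 * Real.log (2 * U)) * lam / ((σ - 1 / 2) * Y ^ (σ - 1 / 2) / 2 ^ 20)) +
          (1 + Real.log X) ^ 3 * X * (U + 2 * (100 * Real.log (2 * U))) *
            (2 * (100 * Real.log (2 * U)) * lam / ((σ - 1 / 2) * Y ^ (σ - 1 / 2) / 2 ^ 20)) ^ 3 *
            Real.log (X * (U + 2 * (100 * Real.log (2 * U)))) ^ 4) := by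
  classical
  -- abbreviations
  set δ : ℝ := σ - 1 / 2 with hδ
  have hδ0 : 0 < δ := by rw [hδ]; linarith
  set T : ℝ := 2 * U with hT
  set l : ℝ := Real.log T with hl
  set A : ℝ := 100 * l with hA
  set N₀ : ℕ := ⌊100 * l * Y⌋₊ with hN₀
  set W₀ : ℝ := δ * Y ^ (σ - 1 / 2) / 2 ^ 20 with hW₀
  have hT1 : 1 ≤ T := by rw [hT]; linarith
  have hT3 : 3 ≤ T := by
    have : 0 < 2 ^ 36 / δ := by positivity
    linarith
  have hl1 : 1 ≤ l := by
    rw [hl, Real.le_log_iff_exp_le (by linarith)]; linarith [Real.exp_one_lt_d9]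
  have hA100 : 100 ≤ A := by rw [hA]; linarith
  have hA0 : 0 < A := by linarith
  have hAU : 2 * A ≤ U := by rw [hA]; linarith
  have hY1 : 1 ≤ Y := by linarith
  have hY0 : 0 < Y := by linarith
  have hW₀0 : 0 < W₀ := by rw [hW₀]; positivity
  have hX1 : 1 ≤ X := le_trans (by norm_num) hX2
  have hX0 : (0 : ℝ) < X := by exact_mod_cast (lt_of_lt_of_le (by norm_num) hX1)
  have hN₀1 : 1 ≤ N₀ := by rw [hN₀, Nat.one_le_floor_iff]; nlinarith
  -- the zero-detecting coefficients
  set c : ℕ → ℂ := smoothed (mollCoeff X) Y with hc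
  have hcd : ∀ n, ‖c n‖ ≤ (n.divisors.card : ℝ) := fun n ↦
    (norm_smoothed_le _ hY0 n).trans (norm_mollCoeff_le X n)
  -- facts about the zeros
  have hre : ∀ ρ ∈ Z, σ ≤ ρ.re ∧ ρ.re < 1 := fun ρ hρ ↦
    ⟨(hZ ρ hρ).2.1, LFunctions.re_lt_one_of_riemannZeta_eq_zero (hZ ρ hρ).1⟩
  have hdist : ∀ ρ ∈ Z, ∀ ρ' ∈ Z, |ρ.im - ρ'.im| ≤ U := by
    intro ρ hρ ρ' hρ'
    have h1 := (hZ ρ hρ).2.2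
    have h2 := (hZ ρ' hρ').2.2
    rw [abs_le]; constructor <;> linarith [h1.1, h1.2, h2.1, h2.2]
  -- `log (2 N₀) ≤ 3A`
  have hN₀le : (N₀ : ℝ) ≤ 100 * l * Y := Nat.floor_le (by positivity)
  have hlogN : Real.log (2 * N₀) ≤ 3 * A := by
    have h1 : (2 * N₀ : ℝ) ≤ 200 * l * T ^ 2 := by
      have : Y ≤ T ^ 2 := hYT
      nlinarith
    have h2 : Real.log (2 * N₀) ≤ Real.log (200 * l * T ^ 2) :=
      Real.log_le_log (by positivity) h1
    have h3 : Real.log (200 * l * T ^ 2) = Real.log 200 + Real.log l + 2 * Real.log T := by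
      rw [Real.log_mul (by positivity) (by positivity), Real.log_mul (by norm_num) (by positivity),
        Real.log_pow]; push_cast; ring
    have h4 : Real.log l ≤ l := (Real.log_le_sub_one_of_pos (by linarith)).trans (by linarith)
    rw [h3] at h2
    have := log_two_hundred_le
    rw [hA]; rw [← hl] at h2; linarith
  -- the three classes
  set P : ℂ → ℝ := fun ρ ↦ ∫ y in (-A)..A, ‖riemannZeta (1 / 2 + ((ρ.im + y : ℝ) : ℂ) * I)‖ ^ 2 with hP
  set Q : ℂ → ℝ := fun ρ ↦ ∫ y in (-A)..A, ‖mollifier X (1 / 2 + ((ρ.im + y : ℝ) : ℂ) * I)‖ ^ 2 with hQ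
  set ZI := Z.filter (fun ρ ↦ 1 / 3 < ‖∑ n ∈ Finset.Ioc X N₀, c n * (n : ℂ) ^ (-ρ)‖) with hZI
  set ZA := Z.filter (fun ρ ↦ lam * W₀ ≤ P ρ) with hZA
  set ZB := Z.filter (fun ρ ↦ W₀ / lam ≤ Q ρ) with hZB
  have hcover : Z ⊆ ZI ∪ (ZA ∪ ZB) := by
    intro ρ hρ
    obtain ⟨hζ, hβ, hγ1, hγ2⟩ := hZ ρ hρ
    have hγ : 100 * Real.log T ≤ |ρ.im| := by
      rw [abs_of_pos (by linarith)]; rw [← hl]; linarith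
    have hγT : |ρ.im| ≤ T := by rw [abs_of_pos (by linarith)]; linarith
    have hdich := zeroDetection_integral hδ0 hTδ hX1 hXT hY hYT hζ (by rw [hδ]; linarith) hγ hγT
    rw [Finset.mem_union, Finset.mem_union, hZI, hZA, hZB, Finset.mem_filter, Finset.mem_filter,
      Finset.mem_filter]
    rcases hdich with h1 | h2
    · exact Or.inl ⟨hρ, h1⟩
    · right
      -- `W₀ ≤ δ Y^{β-1/2}/2^20 ≤ ∫ |ζ M|`
      have hW : W₀ ≤ ∫ y in (-(100 * Real.log T))..(100 * Real.log T),
          ‖riemannZeta (1 / 2 + ((ρ.im + y : ℝ) : ℂ) * I) * mollifier X (1 / 2 + ((ρ.im + y : ℝ) : ℂ) * I)‖ := by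
        refine le_trans ?_ h2
        rw [hW₀]
        gcongr
      have hW' : W₀ ≤ ∫ y in (-A)..A,
          ‖riemannZeta (1 / 2 + ((ρ.im + y : ℝ) : ℂ) * I) * mollifier X (1 / 2 + ((ρ.im + y : ℝ) : ℂ) * I)‖ := by
        rw [hA, hl]; exact hW
      have hsplit := classTwo_split (FourthMoment.continuous_zeta_half_line'.comp (by fun_prop))
        ((ZeroDensity.continuous_mollifier_half_line X).comp (by fun_prop)) hA0.le hW₀0 hlam hW'
      rcases hsplit with ha | hb
      · exact Or.inl ⟨hρ, ha⟩
      · exact Or.inr ⟨hρ, hb⟩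
  -- class (i)
  have hsepI : ∀ ρ ∈ Z, ∀ ρ' ∈ Z, ρ ≠ ρ' → Real.log (2 * N₀) ≤ |ρ.im - ρ'.im| ∧ |ρ.im - ρ'.im| ≤ T := by
    intro ρ hρ ρ' hρ' hne
    refine ⟨hlogN.trans ?_, (hdist ρ hρ ρ' hρ').trans (by linarith)⟩
    have := hsep ρ hρ ρ' hρ' hne; rw [hA, hl]; exact this
  have hI := classOne_card_le hCb0 hCb hη hd hcd hσ hσ1.le hT1 hX1 hN₀1 hJ Z hre hsepI
  -- class (ii a)
  have hZA_Z : ∀ ρ ∈ ZA, U < ρ.im ∧ ρ.im ≤ 2 * U := fun ρ hρ ↦ by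
    rw [hZA, Finset.mem_filter] at hρ; exact (hZ ρ hρ.1).2.2
  have hsepA : ∀ ρ ∈ ZA, ∀ ρ' ∈ ZA, ρ ≠ ρ' → 2 * A ≤ |ρ.im - ρ'.im| := by
    intro ρ hρ ρ' hρ' hne
    rw [hZA, Finset.mem_filter] at hρ hρ'
    have := hsep ρ hρ.1 ρ' hρ'.1 hne; rw [hA, hl]; linarith
  have hlargeA : ∀ ρ ∈ ZA, lam * W₀ ≤ ∫ y in (-A)..A, ‖riemannZeta (1 / 2 + ((ρ.im + y : ℝ) : ℂ) * I)‖ ^ 2 := by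
    intro ρ hρ; rw [hZA, Finset.mem_filter] at hρ; exact hρ.2
  have hIIa := card_classTwoA_le hU hA0 (by linarith) ZA hZA_Z hsepA hlargeA h4 (by positivity)
  have hIIa' : (ZA.card : ℝ) ≤ 2 * A * (C₄ * (3 * U) ^ (1 + η)) / (lam * W₀) ^ 2 := by
    rw [le_div_iff₀ (by positivity)]; exact hIIa
  -- class (ii b)
  have hsepB : ∀ ρ ∈ ZB, ∀ ρ' ∈ ZB, ρ ≠ ρ' → 3 * A ≤ |ρ.im - ρ'.im| ∧ |ρ.im - ρ'.im| ≤ U := by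
    intro ρ hρ ρ' hρ' hne
    rw [hZB, Finset.mem_filter] at hρ hρ'
    have := hsep ρ hρ.1 ρ' hρ'.1 hne
    rw [hA, hl]
    exact ⟨this, hdist ρ hρ.1 ρ' hρ'.1⟩
  have hlargeB : ∀ ρ ∈ ZB, W₀ / lam ≤ ∫ y in (-A)..A, ‖mollifier X (1 / 2 + ((ρ.im + y : ℝ) : ℂ) * I)‖ ^ 2 := by
    intro ρ hρ; rw [hZB, Finset.mem_filter] at hρ; exact hρ.2
  have hlogX : Real.log X ≤ A := by
    have : Real.log X ≤ Real.log (T ^ 2) := Real.log_le_log hX0 hXT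
    rw [Real.log_pow] at this; push_cast at this
    rw [hA]; linarith
  have hIIb := hCc X A U (W₀ / lam) ZB hX2 hA0 hlogX (by linarith) (by linarith) (div_pos hW₀0 hlam)
    hsepB hlargeB
  have e1 : 2 * A / (W₀ / lam) = 2 * A * lam / W₀ := by field_simp
  rw [e1] at hIIb
  -- total
  have htot : (Z.card : ℝ) ≤ ZI.card + (ZA.card + ZB.card) := by
    have h1 : Z.card ≤ ZI.card + (ZA ∪ ZB).card :=
      (Finset.card_le_card hcover).trans (Finset.card_union_le _ _)
    have h2 : (ZA ∪ ZB).card ≤ ZA.card + ZB.card := Finset.card_union_le _ _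
    exact_mod_cast h1.trans (Nat.add_le_add_left h2 _)
  rw [← hZI] at hI
  calc (Z.card : ℝ) ≤ ZI.card + (ZA.card + ZB.card) := htot
    _ ≤ _ := add_le_add hI (add_le_add hIIa' hIIb)
    _ = _ := by ring


/-! ## §8. The choice of the parameters (Huxley (28.9)–(28.10), (28.17)–(28.18)) -/

/-- `log 100 ≤ 5`. [folklore] -/
theorem log_hundred_le : Real.log 100 ≤ 5 := by
  rw [Real.log_le_iff_le_exp (by norm_num)]
  have h := Real.exp_one_gt_d9
  have h5 : (2.7182818283 : ℝ) ^ 5 ≤ Real.exp 1 ^ 5 := pow_le_pow_left₀ (by norm_num) h.le 5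
  have he : Real.exp 1 ^ 5 = Real.exp 5 := by rw [← Real.exp_nat_mul]; norm_num
  have h100 : (100 : ℝ) ≤ (2.7182818283 : ℝ) ^ 5 := by norm_num
  rw [he] at h5
  exact h100.trans h5

/-- `4 ≤ T^{1/4}` for `T ≥ 256`. [folklore] -/
theorem four_le_rpow_quarter {T : ℝ} (hT : 256 ≤ T) : (4 : ℝ) ≤ T ^ (1 / 4 : ℝ) := by
  have h1 : ((4 : ℝ) ^ 4) ^ ((4 : ℕ)⁻¹ : ℝ) = 4 := Real.pow_rpow_inv_natCast (by norm_num) (by norm_num)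
  have h2 : ((4 : ℝ) ^ 4) ^ ((4 : ℕ)⁻¹ : ℝ) ≤ T ^ ((4 : ℕ)⁻¹ : ℝ) :=
    Real.rpow_le_rpow (by norm_num) (by norm_num; linarith) (by positivity)
  rw [h1] at h2
  convert h2 using 2
  norm_num

/-- `Nat.log 2 N ≤ 2 log N` (real logarithm) for `N ≥ 1`. [folklore] -/
theorem natLog_two_le (N : ℕ) (hN : 1 ≤ N) : (Nat.log 2 N : ℝ) ≤ 2 * Real.log N := by
  have h1 : ((2 ^ Nat.log 2 N : ℕ) : ℝ) ≤ N := by exact_mod_cast Nat.pow_log_le_self 2 (by omega)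
  have h2 : Real.log ((2 ^ Nat.log 2 N : ℕ) : ℝ) ≤ Real.log N := Real.log_le_log (by positivity) h1
  push_cast at h2
  rw [Real.log_pow] at h2
  have h3 := Real.log_two_gt_d9
  have h4 : 0 ≤ Real.log N := Real.log_nonneg (by exact_mod_cast hN)
  nlinarith

/-- Eventually `400 log(2U) ≤ 2U`. [folklore] -/
theorem eventually_log_le : ∀ᶠ U : ℝ in atTop, 400 * Real.log (2 * U) ≤ 2 * U := by
  have h1 : ∀ᶠ x : ℝ in atTop, ‖Real.log x‖ ≤ 1 / 400 * ‖x‖ :=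
    Real.isLittleO_log_id_atTop.bound (by norm_num)
  have h2 : Tendsto (fun U : ℝ ↦ 2 * U) atTop atTop :=
    Filter.Tendsto.const_mul_atTop (by norm_num) tendsto_id
  filter_upwards [h2.eventually h1, eventually_ge_atTop (1 : ℝ)] with U hU hU1
  rw [Real.norm_of_nonneg (Real.log_nonneg (by linarith)), Real.norm_of_nonneg (by linarith)] at hU
  linarith

set_option maxHeartbeats 800000 in
/-- **The count of a well-separated set of zeros** (Huxley Ch. 28 up to (28.19), with the
parameters (28.17)–(28.18) `X = T^{x₀}`, `Y = T^{y₀}`, `T = 2U`, and the split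
`λ = T^{(1−κ)/2}/Y^{σ−1/2}` of the class (ii) condition, i.e. `U = T^{(1-κ)/4}` in (28.9)):
for `3/4 ≤ σ < 1`, `0 < η ≤ 1/24`, there are `U₀, C` such that every finite set of zeros
`ρ = β + iγ` of `ζ` with `β ≥ σ`, `U < γ ≤ 2U` (`U ≥ U₀`), ordinates pairwise `≥ 300 log 2U`
apart, has at most `C log¹²(2U) (2U)^{κ(σ) + 12η}` elements, `κ(σ) = (5σ−3)(1−σ)/(σ²+σ−1)`.
[cite: Huxley1972, Ch. 28, (28.9)–(28.19)] -/
theorem card_sep_le (h4 : zetaFourthMomentWeak) {σ : ℝ} (hσ : 3 / 4 ≤ σ) (hσ1 : σ < 1) {η : ℝ}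
    (hη : 0 < η) (hη1 : η ≤ 1 / 24) :
    ∃ U₀ C : ℝ, 1 ≤ U₀ ∧ 0 ≤ C ∧ ∀ U : ℝ, U₀ ≤ U → ∀ Z : Finset ℂ,
      (∀ ρ ∈ Z, riemannZeta ρ = 0 ∧ σ ≤ ρ.re ∧ U < ρ.im ∧ ρ.im ≤ 2 * U) →
      (∀ ρ ∈ Z, ∀ ρ' ∈ Z, ρ ≠ ρ' → 3 * (100 * Real.log (2 * U)) ≤ |ρ.im - ρ'.im|) →
      (Z.card : ℝ) ≤ C * Real.log (2 * U) ^ 12 *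
        (2 * U) ^ ((5 * σ - 3) * (1 - σ) / (σ ^ 2 + σ - 1) + 12 * η) := by
  classical
  -- constants
  obtain ⟨C_b, hCb0, hCb⟩ := exists_block_largeValues_const
  obtain ⟨C_c, hCc0, hCc⟩ := card_classTwoB_le
  obtain ⟨C_d, hCd1, hCd⟩ := Literature.NumberTheory.Sieve.exists_card_divisors_le_mul_rpow' hη
  obtain ⟨C₄', hC4'⟩ := h4 η hη
  set C₄ : ℝ := max C₄' 0 with hC4def
  have hC40 : 0 ≤ C₄ := le_max_right _ _
  have hC4 : ∀ T : ℝ, 1 ≤ T → ∫ t in (0 : ℝ)..T, ‖riemannZeta (1 / 2 + t * I)‖ ^ 4 ≤ C₄ * T ^ (1 + η) :=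
    fun T hT ↦ (hC4' T hT).trans (mul_le_mul_of_nonneg_right (le_max_left _ _) (by positivity))
  -- exponents
  obtain ⟨hD, E1, E2, E3, E4, ⟨hx1, hx2⟩, ⟨hy1, hy2⟩, ⟨hk1, hk2⟩⟩ := huxley_exponents hσ hσ1
  set κ : ℝ := (5 * σ - 3) * (1 - σ) / (σ ^ 2 + σ - 1) with hκ
  set x₀ : ℝ := (2 * σ - 1) / (2 * (σ ^ 2 + σ - 1)) with hx₀
  set y₀ : ℝ := (5 * σ - 3) / (2 * (σ ^ 2 + σ - 1)) with hy₀
  set δ : ℝ := σ - 1 / 2 with hδ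
  have hδ4 : 1 / 4 ≤ δ := by rw [hδ]; linarith
  have hδ0 : 0 < δ := by linarith
  have hδ2 : δ ≤ 1 / 2 := by rw [hδ]; linarith
  -- the constant
  set K : ℝ := 18 * 17 ^ 3 * 20000 * C_b * C_d ^ 2 + 1458 * 17 ^ 7 * 10 ^ 4 * 800 * C_b * C_d ^ 6 +
    200 * 2 ^ 40 * 16 * 4 * C₄ + C_c * 2 * (200 * 2 ^ 20 * 4) +
    C_c * 8 * (200 * 2 ^ 20 * 4) ^ 3 * 16 with hK
  have hK0 : 0 ≤ K := by rw [hK]; positivity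
  -- the threshold
  obtain ⟨U₁, hU₁⟩ := Filter.eventually_atTop.1 eventually_log_le
  refine ⟨max U₁ (2 ^ 38), K, le_max_of_le_right (by norm_num), hK0, fun U hU Z hZ hsep ↦ ?_⟩
  have hUU₁ : U₁ ≤ U := le_trans (le_max_left _ _) hU
  have hU38 : (2 : ℝ) ^ 38 ≤ U := le_trans (le_max_right _ _) hU
  have hU1 : 1 ≤ U := le_trans (by norm_num) hU38
  have hlT := hU₁ U hUU₁
  set T : ℝ := 2 * U with hT
  set l : ℝ := Real.log T with hl
  have hT1 : 1 ≤ T := by rw [hT]; linarith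
  have hT0 : 0 < T := by linarith
  have hT256 : 256 ≤ T := by rw [hT]; linarith
  have hT3 : 3 ≤ T := by linarith
  have hl1 : 1 ≤ l := by
    rw [hl, Real.le_log_iff_exp_le (by linarith)]; linarith [Real.exp_one_lt_d9]
  have hl0 : 0 < l := by linarith
  have hTδ : 2 ^ 36 / (σ - 1 / 2) + 3 ≤ T := by
    rw [← hδ]
    have : 2 ^ 36 / δ ≤ 2 ^ 36 / (1 / 4) := div_le_div_of_nonneg_left (by norm_num) (by norm_num) hδ4
    rw [hT]; linarith
  -- `X`
  set X : ℕ := ⌊T ^ x₀⌋₊ with hXdef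
  have hTx4 : 4 ≤ T ^ x₀ :=
    (four_le_rpow_quarter hT256).trans (Real.rpow_le_rpow_of_exponent_le hT1 hx1)
  have hTx0 : 0 < T ^ x₀ := by positivity
  have hX2 : 2 ≤ X := Nat.le_floor (by push_cast; linarith)
  have hXup : (X : ℝ) ≤ T ^ x₀ := Nat.floor_le hTx0.le
  have hXlow : T ^ x₀ / 2 ≤ X := by
    have := Nat.lt_floor_add_one (T ^ x₀); rw [← hXdef] at this; linarith
  have hXpos : (0 : ℝ) < X := by linarith
  have hXT : (X : ℝ) ≤ T := hXup.trans (Real.rpow_le_self_of_one_le hT1 hx2)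
  have hXT2 : (X : ℝ) ≤ (2 * U) ^ 2 := by rw [← hT]; exact hXT.trans (le_self_pow₀ hT1 two_ne_zero)
  -- `Y`
  set Y : ℝ := T ^ y₀ with hYdef
  have hY0 : 0 < Y := by positivity
  have hYT' : T ≤ Y := by
    calc T = T ^ (1 : ℝ) := (Real.rpow_one T).symm
      _ ≤ T ^ y₀ := Real.rpow_le_rpow_of_exponent_le hT1 hy1
  have hY10 : 10 ≤ Y := by linarith
  have hY1 : 1 ≤ Y := by linarith
  have hYT : Y ≤ (2 * U) ^ 2 := by
    rw [← hT]
    calc Y ≤ T ^ (2 : ℝ) := Real.rpow_le_rpow_of_exponent_le hT1 hy2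
      _ = T ^ 2 := by norm_cast
  -- `N₀`, `J`, `λ`
  set N₀ : ℕ := ⌊100 * l * Y⌋₊ with hN₀
  have hN₀le : (N₀ : ℝ) ≤ 100 * l * Y := Nat.floor_le (by positivity)
  have hN₀1 : 1 ≤ N₀ := by
    rw [hN₀, Nat.one_le_floor_iff]
    exact one_le_mul_of_one_le_of_one_le (by linarith) hY1
  have hN₀pos : (0 : ℝ) < N₀ := by exact_mod_cast hN₀1
  set J : ℕ := Nat.log 2 N₀ + 1 with hJdef
  have hJ : N₀ < 2 ^ J := Nat.lt_pow_succ_log_self (by norm_num) N₀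
  set lam : ℝ := T ^ ((1 - κ) / 2 - y₀ * (σ - 1 / 2)) with hlamdef
  have hlam : 0 < lam := by positivity
  -- the raw bound
  have hraw := card_sep_le_raw hCb0 hCb hCc hη.le hCd hC4 hσ hσ1 hU1 (by rw [← hT]; exact hTδ)
    (by rw [← hT, ← hl]; exact hlT) hX2 hXT2 hY10 hYT (by rw [← hT, ← hl]; exact hJ) hlam Z hZ hsep
  rw [← hl] at hraw
  rw [← hN₀] at hraw
  rw [← hδ] at hraw
  -- ### elementary facts
  have hlogl : Real.log l ≤ l := (Real.log_le_sub_one_of_pos hl0).trans (by linarith)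
  have hYT2 : Y ≤ T ^ 2 := by
    calc Y ≤ T ^ (2 : ℝ) := Real.rpow_le_rpow_of_exponent_le hT1 hy2
      _ = T ^ 2 := by norm_cast
  have h200l : (1 : ℝ) ≤ 200 * l := by linarith
  have h100l : (1 : ℝ) ≤ 100 * l := by linarith
  -- `log N₀ ≤ 8 l`, `J ≤ 17 l`
  have hlogN₀ : Real.log N₀ ≤ 8 * l := by
    have h1 : (N₀ : ℝ) ≤ 100 * l * T ^ 2 := hN₀le.trans (by gcongr)
    have h2 : Real.log N₀ ≤ Real.log (100 * l * T ^ 2) := Real.log_le_log hN₀pos h1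
    have h3 : Real.log (100 * l * T ^ 2) = Real.log 100 + Real.log l + 2 * Real.log T := by
      rw [Real.log_mul (by positivity) (by positivity), Real.log_mul (by norm_num) (by positivity),
        Real.log_pow]; push_cast; ring
    rw [h3, ← hl] at h2
    linarith [log_hundred_le]
  have hJ17 : (J : ℝ) ≤ 17 * l := by
    have h1 : (J : ℝ) = Nat.log 2 N₀ + 1 := by rw [hJdef]; push_cast; ring
    rw [h1]
    have h2 := natLog_two_le N₀ hN₀1
    linarith
  have hJ0 : (0 : ℝ) ≤ J := Nat.cast_nonneg J
  -- `2 N₀`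
  have h2N₀ : 2 * (N₀ : ℝ) ≤ 200 * l * Y := by linarith
  have h2N₀pos : 0 < 2 * (N₀ : ℝ) := by positivity
  have hYpow : ∀ e : ℝ, Y ^ e = T ^ (y₀ * e) := fun e ↦ by rw [hYdef, ← Real.rpow_mul hT0.le]
  have hA1 : (2 * (N₀ : ℝ)) ^ (2 * η) ≤ 200 * l * T ^ (4 * η) := by
    calc (2 * (N₀ : ℝ)) ^ (2 * η) ≤ (200 * l * Y) ^ (2 * η) :=
          Real.rpow_le_rpow h2N₀pos.le h2N₀ (by positivity)
      _ = (200 * l) ^ (2 * η) * Y ^ (2 * η) := Real.mul_rpow (by positivity) hY0.le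
      _ ≤ (200 * l) * T ^ (4 * η) := by
          refine mul_le_mul (Real.rpow_le_self_of_one_le h200l (by linarith)) ?_ (by positivity) (by positivity)
          rw [hYpow]
          refine Real.rpow_le_rpow_of_exponent_le hT1 ?_
          have := mul_le_mul_of_nonneg_right hy2 (by positivity : (0 : ℝ) ≤ 2 * η)
          linarith
  have hA2 : (2 * (N₀ : ℝ)) ^ (6 * η) ≤ 200 * l * T ^ (12 * η) := by
    calc (2 * (N₀ : ℝ)) ^ (6 * η) ≤ (200 * l * Y) ^ (6 * η) :=
          Real.rpow_le_rpow h2N₀pos.le h2N₀ (by positivity)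
      _ = (200 * l) ^ (6 * η) * Y ^ (6 * η) := Real.mul_rpow (by positivity) hY0.le
      _ ≤ (200 * l) * T ^ (12 * η) := by
          refine mul_le_mul (Real.rpow_le_self_of_one_le h200l (by linarith)) ?_ (by positivity) (by positivity)
          rw [hYpow]
          refine Real.rpow_le_rpow_of_exponent_le hT1 ?_
          have := mul_le_mul_of_nonneg_right hy2 (by positivity : (0 : ℝ) ≤ 6 * η)
          linarith
  have hA3 : (N₀ : ℝ) ^ (2 - 2 * σ) ≤ 100 * l * T ^ κ := by
    calc (N₀ : ℝ) ^ (2 - 2 * σ) ≤ (100 * l * Y) ^ (2 - 2 * σ) :=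
          Real.rpow_le_rpow hN₀pos.le hN₀le (by linarith)
      _ = (100 * l) ^ (2 - 2 * σ) * Y ^ (2 - 2 * σ) := Real.mul_rpow (by positivity) hY0.le
      _ ≤ (100 * l) * T ^ κ := by
          refine mul_le_mul (Real.rpow_le_self_of_one_le h100l (by linarith)) ?_ (by positivity) (by positivity)
          rw [hYpow, E1]
  have hN₀1r : (1 : ℝ) ≤ N₀ := by exact_mod_cast hN₀1
  have hA4 : Real.log (2 * N₀ * T) ^ 4 ≤ 10 ^ 4 * l ^ 4 := by
    have h0 : 0 ≤ Real.log (2 * N₀ * T) :=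
      Real.log_nonneg (one_le_mul_of_one_le_of_one_le (by linarith) hT1)
    have h1 : 2 * (N₀ : ℝ) * T ≤ 200 * l * T ^ 3 := by
      have h1' : 2 * (N₀ : ℝ) ≤ 200 * l * T ^ 2 := h2N₀.trans (by gcongr)
      calc 2 * (N₀ : ℝ) * T ≤ 200 * l * T ^ 2 * T := mul_le_mul_of_nonneg_right h1' hT0.le
        _ = 200 * l * T ^ 3 := by ring
    have h2 : Real.log (2 * N₀ * T) ≤ Real.log (200 * l * T ^ 3) := Real.log_le_log (by positivity) h1
    have h3 : Real.log (200 * l * T ^ 3) = Real.log 200 + Real.log l + 3 * Real.log T := by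
      rw [Real.log_mul (by positivity) (by positivity), Real.log_mul (by norm_num) (by positivity),
        Real.log_pow]; push_cast; ring
    rw [h3, ← hl] at h2
    have h4 : Real.log (2 * N₀ * T) ≤ 10 * l := by linarith [log_two_hundred_le]
    calc Real.log (2 * N₀ * T) ^ 4 ≤ (10 * l) ^ 4 := pow_le_pow_left₀ h0 h4 4
      _ = 10 ^ 4 * l ^ 4 := by ring
  have hA5 : (X : ℝ) ^ (4 - 6 * σ) ≤ 4 * T ^ (κ - 1) := by
    have hx2pos : 0 < T ^ x₀ / 2 := by positivity
    calc (X : ℝ) ^ (4 - 6 * σ) ≤ (T ^ x₀ / 2) ^ (4 - 6 * σ) :=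
          Real.rpow_le_rpow_of_nonpos hx2pos hXlow (by linarith)
      _ = (T ^ x₀) ^ (4 - 6 * σ) / (2 : ℝ) ^ (4 - 6 * σ) := Real.div_rpow hTx0.le (by norm_num) _
      _ = T ^ (κ - 1) * (2 : ℝ) ^ (-(4 - 6 * σ)) := by
          rw [← Real.rpow_mul hT0.le, Real.rpow_neg (by norm_num), div_eq_mul_inv]
          congr 2; linarith
      _ ≤ T ^ (κ - 1) * 4 := by
          refine mul_le_mul_of_nonneg_left ?_ (by positivity)
          calc (2 : ℝ) ^ (-(4 - 6 * σ)) ≤ (2 : ℝ) ^ (2 : ℝ) :=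
                Real.rpow_le_rpow_of_exponent_le (by norm_num) (by linarith)
            _ = 4 := by norm_num
      _ = 4 * T ^ (κ - 1) := by ring
  have hA6 : 1 + Real.log X ≤ 2 * l := by
    have h1 : Real.log X ≤ Real.log (T ^ x₀) := Real.log_le_log hXpos hXup
    rw [Real.log_rpow hT0, ← hl] at h1
    have h2 : x₀ * l ≤ l := mul_le_of_le_one_left hl0.le hx2
    linarith
  have hlogX0 : 0 ≤ Real.log X := Real.log_nonneg (by exact_mod_cast (le_trans (by norm_num) hX2))
  have hA6' : 0 ≤ 1 + Real.log X := by linarith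
  -- `λ W₀` and `2Aλ/W₀`
  set e₂ : ℝ := (1 - κ) / 2 - y₀ * (2 * σ - 1) with he₂
  have hYδ : Y ^ δ = T ^ (y₀ * δ) := hYpow δ
  have hlamY : lam * T ^ (y₀ * δ) = T ^ ((1 - κ) / 2) := by
    rw [hlamdef, ← Real.rpow_add hT0]; congr 1; rw [hδ]; ring
  have hlam2 : lam = T ^ e₂ * T ^ (y₀ * δ) := by
    rw [hlamdef, ← Real.rpow_add hT0]; congr 1; rw [he₂, hδ]; ring
  have hW₀pos : 0 < δ * Y ^ δ / 2 ^ 20 := by positivity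
  have hden : (lam * (δ * Y ^ δ / 2 ^ 20)) ^ 2 = δ ^ 2 * T ^ (1 - κ) / 2 ^ 40 := by
    have e : lam * (δ * Y ^ δ / 2 ^ 20) = δ * T ^ ((1 - κ) / 2) / 2 ^ 20 := by
      rw [hYδ, ← hlamY]; ring
    rw [e, div_pow, mul_pow, ← Real.rpow_natCast (T ^ ((1 - κ) / 2)), ← Real.rpow_mul hT0.le]
    norm_num
  have hratio : 2 * (100 * l) * lam / (δ * Y ^ δ / 2 ^ 20) = 200 * 2 ^ 20 / δ * l * T ^ e₂ := by
    rw [div_eq_iff hW₀pos.ne', hlam2, hYδ]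
    field_simp
    ring
  have hratio_le : 2 * (100 * l) * lam / (δ * Y ^ δ / 2 ^ 20) ≤ (200 * 2 ^ 20 * 4) * l * T ^ e₂ := by
    rw [hratio]
    have : 200 * 2 ^ 20 / δ ≤ 200 * 2 ^ 20 * 4 := by
      rw [div_le_iff₀ hδ0]; linarith
    exact mul_le_mul_of_nonneg_right (mul_le_mul_of_nonneg_right this hl0.le) (by positivity)
  -- ### the five terms
  -- (I-1)
  have hI1 : (J : ℝ) * C_b * (18 * C_d ^ 2 * (J : ℝ) ^ 2 * (2 * (N₀ : ℝ)) ^ (2 * η) * (N₀ : ℝ) ^ (2 - 2 * σ)) ≤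
      (18 * 17 ^ 3 * 20000 * C_b * C_d ^ 2) * l ^ 5 * T ^ (κ + 4 * η) := by
    calc (J : ℝ) * C_b * (18 * C_d ^ 2 * (J : ℝ) ^ 2 * (2 * (N₀ : ℝ)) ^ (2 * η) * (N₀ : ℝ) ^ (2 - 2 * σ))
        ≤ (17 * l) * C_b * (18 * C_d ^ 2 * (17 * l) ^ 2 * (200 * l * T ^ (4 * η)) * (100 * l * T ^ κ)) := by
          gcongr
      _ = (18 * 17 ^ 3 * 20000 * C_b * C_d ^ 2) * l ^ 5 * (T ^ (4 * η) * T ^ κ) := by ring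
      _ = (18 * 17 ^ 3 * 20000 * C_b * C_d ^ 2) * l ^ 5 * T ^ (κ + 4 * η) := by
          rw [← Real.rpow_add hT0]; congr 2; ring
  -- (I-2)
  have hI2 : (J : ℝ) * C_b * (1458 * C_d ^ 6 * (J : ℝ) ^ 6 * T * Real.log (2 * N₀ * T) ^ 4 *
      (2 * (N₀ : ℝ)) ^ (6 * η) * (X : ℝ) ^ (4 - 6 * σ)) ≤
      (1458 * 17 ^ 7 * 10 ^ 4 * 800 * C_b * C_d ^ 6) * l ^ 12 * T ^ (κ + 12 * η) := by
    calc (J : ℝ) * C_b * (1458 * C_d ^ 6 * (J : ℝ) ^ 6 * T * Real.log (2 * N₀ * T) ^ 4 *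
          (2 * (N₀ : ℝ)) ^ (6 * η) * (X : ℝ) ^ (4 - 6 * σ))
        ≤ (17 * l) * C_b * (1458 * C_d ^ 6 * (17 * l) ^ 6 * T * (10 ^ 4 * l ^ 4) *
            (200 * l * T ^ (12 * η)) * (4 * T ^ (κ - 1))) := by
          gcongr
      _ = (1458 * 17 ^ 7 * 10 ^ 4 * 800 * C_b * C_d ^ 6) * l ^ 12 * (T * T ^ (12 * η) * T ^ (κ - 1)) := by
          ring
      _ = (1458 * 17 ^ 7 * 10 ^ 4 * 800 * C_b * C_d ^ 6) * l ^ 12 * T ^ (κ + 12 * η) := by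
          congr 1
          rw [show T * T ^ (12 * η) = T ^ (1 + 12 * η) by rw [Real.rpow_add hT0, Real.rpow_one],
            ← Real.rpow_add hT0]
          congr 1; ring
  -- (II-a)
  have hIIa : 2 * (100 * l) * (C₄ * (3 * U) ^ (1 + η)) / (lam * (δ * Y ^ δ / 2 ^ 20)) ^ 2 ≤
      (200 * 2 ^ 40 * 16 * 4 * C₄) * l * T ^ (κ + η) := by
    rw [hden, div_le_iff₀ (by positivity)]
    have h3U : (3 * U) ^ (1 + η) ≤ 4 * T ^ (1 + η) := by
      calc (3 * U) ^ (1 + η) ≤ (2 * T) ^ (1 + η) :=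
            Real.rpow_le_rpow (by positivity) (by rw [hT]; linarith) (by positivity)
        _ = (2 : ℝ) ^ (1 + η) * T ^ (1 + η) := Real.mul_rpow (by norm_num) hT0.le
        _ ≤ 4 * T ^ (1 + η) := by
            refine mul_le_mul_of_nonneg_right ?_ (by positivity)
            calc (2 : ℝ) ^ (1 + η) ≤ (2 : ℝ) ^ (2 : ℝ) :=
                  Real.rpow_le_rpow_of_exponent_le (by norm_num) (by linarith)
              _ = 4 := by norm_num
    have hTT : T ^ (κ + η) * T ^ (1 - κ) = T ^ (1 + η) := by
      rw [← Real.rpow_add hT0]; congr 1; ring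
    have hδsq : 1 / 16 ≤ δ ^ 2 := by
      have := pow_le_pow_left₀ (by norm_num) hδ4 2
      norm_num at this
      exact this
    calc 2 * (100 * l) * (C₄ * (3 * U) ^ (1 + η)) ≤ 2 * (100 * l) * (C₄ * (4 * T ^ (1 + η))) := by gcongr
      _ = 800 * (C₄ * l * T ^ (1 + η)) := by ring
      _ ≤ (200 * 16 * 4 * δ ^ 2) * (C₄ * l * T ^ (1 + η)) :=
          mul_le_mul_of_nonneg_right (by linarith) (by positivity)
      _ = (200 * 16 * 4 * C₄) * l * δ ^ 2 * T ^ (1 + η) := by ring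
      _ = (200 * 2 ^ 40 * 16 * 4 * C₄) * l * T ^ (κ + η) * (δ ^ 2 * T ^ (1 - κ) / 2 ^ 40) := by
          rw [← hTT]; ring
  -- (II-b-1)
  have hIIb1 : C_c * ((1 + Real.log X) * X * (2 * (100 * l) * lam / (δ * Y ^ δ / 2 ^ 20))) ≤
      (C_c * 2 * (200 * 2 ^ 20 * 4)) * l ^ 2 * T ^ κ := by
    have hTe : T ^ x₀ * T ^ e₂ ≤ T ^ κ := by
      rw [← Real.rpow_add hT0]
      exact Real.rpow_le_rpow_of_exponent_le hT1 (by rw [he₂]; linarith [E4])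
    calc C_c * ((1 + Real.log X) * X * (2 * (100 * l) * lam / (δ * Y ^ δ / 2 ^ 20)))
        ≤ C_c * ((2 * l) * T ^ x₀ * ((200 * 2 ^ 20 * 4) * l * T ^ e₂)) := by gcongr
      _ = (C_c * 2 * (200 * 2 ^ 20 * 4)) * l ^ 2 * (T ^ x₀ * T ^ e₂) := by ring
      _ ≤ (C_c * 2 * (200 * 2 ^ 20 * 4)) * l ^ 2 * T ^ κ := by gcongr
  -- (II-b-2)
  have hIIb2 : C_c * ((1 + Real.log X) ^ 3 * X * (U + 2 * (100 * l)) *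
      (2 * (100 * l) * lam / (δ * Y ^ δ / 2 ^ 20)) ^ 3 * Real.log (X * (U + 2 * (100 * l))) ^ 4) ≤
      (C_c * 8 * (200 * 2 ^ 20 * 4) ^ 3 * 16) * l ^ 10 * T ^ κ := by
    have hUA : U + 2 * (100 * l) ≤ T := by rw [hT]; linarith
    have hUA0 : 0 < U + 2 * (100 * l) := by positivity
    have hlog2 : Real.log (X * (U + 2 * (100 * l))) ≤ 2 * l := by
      have h1 : (X : ℝ) * (U + 2 * (100 * l)) ≤ T * T := mul_le_mul hXT hUA hUA0.le hT0.le
      have h2 : Real.log (X * (U + 2 * (100 * l))) ≤ Real.log (T * T) := Real.log_le_log (by positivity) h1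
      rw [Real.log_mul hT0.ne' hT0.ne', ← hl] at h2
      linarith
    have hlog20 : 0 ≤ Real.log (X * (U + 2 * (100 * l))) := by
      refine Real.log_nonneg ?_
      have : (1 : ℝ) ≤ X := by exact_mod_cast (le_trans (by norm_num) hX2)
      exact one_le_mul_of_one_le_of_one_le this (by linarith)
    have hlog4 : Real.log (X * (U + 2 * (100 * l))) ^ 4 ≤ 16 * l ^ 4 := by
      calc Real.log (X * (U + 2 * (100 * l))) ^ 4 ≤ (2 * l) ^ 4 := pow_le_pow_left₀ hlog20 hlog2 4
        _ = 16 * l ^ 4 := by ring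
    have hTe : T ^ x₀ * T * (T ^ e₂) ^ 3 = T ^ κ := by
      rw [← Real.rpow_natCast (T ^ e₂), ← Real.rpow_mul hT0.le]
      conv_lhs => rw [show T ^ x₀ * T = T ^ x₀ * T ^ (1 : ℝ) by rw [Real.rpow_one]]
      rw [← Real.rpow_add hT0, ← Real.rpow_add hT0]
      congr 1; push_cast; rw [he₂]; linarith [E3]
    calc C_c * ((1 + Real.log X) ^ 3 * X * (U + 2 * (100 * l)) *
          (2 * (100 * l) * lam / (δ * Y ^ δ / 2 ^ 20)) ^ 3 * Real.log (X * (U + 2 * (100 * l))) ^ 4)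
        ≤ C_c * ((2 * l) ^ 3 * T ^ x₀ * T * (((200 * 2 ^ 20 * 4) * l * T ^ e₂)) ^ 3 * (16 * l ^ 4)) := by
          gcongr
      _ = (C_c * 8 * (200 * 2 ^ 20 * 4) ^ 3 * 16) * l ^ 10 * (T ^ x₀ * T * (T ^ e₂) ^ 3) := by ring
      _ = (C_c * 8 * (200 * 2 ^ 20 * 4) ^ 3 * 16) * l ^ 10 * T ^ κ := by rw [hTe]
  -- ### total
  have hraw' : (Z.card : ℝ) ≤
      (J : ℝ) * C_b * (18 * C_d ^ 2 * (J : ℝ) ^ 2 * (2 * (N₀ : ℝ)) ^ (2 * η) * (N₀ : ℝ) ^ (2 - 2 * σ)) +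
      (J : ℝ) * C_b * (1458 * C_d ^ 6 * (J : ℝ) ^ 6 * T * Real.log (2 * N₀ * T) ^ 4 *
        (2 * (N₀ : ℝ)) ^ (6 * η) * (X : ℝ) ^ (4 - 6 * σ)) +
      2 * (100 * l) * (C₄ * (3 * U) ^ (1 + η)) / (lam * (δ * Y ^ δ / 2 ^ 20)) ^ 2 +
      C_c * ((1 + Real.log X) * X * (2 * (100 * l) * lam / (δ * Y ^ δ / 2 ^ 20))) +
      C_c * ((1 + Real.log X) ^ 3 * X * (U + 2 * (100 * l)) *
        (2 * (100 * l) * lam / (δ * Y ^ δ / 2 ^ 20)) ^ 3 * Real.log (X * (U + 2 * (100 * l))) ^ 4) :=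
    hraw.trans (le_of_eq (by ring))
  -- powers of `l` and `T`
  have hl5 : l ^ 5 ≤ l ^ 12 := pow_le_pow_right₀ hl1 (by norm_num)
  have hl1' : l ≤ l ^ 12 := by
    calc l = l ^ 1 := (pow_one l).symm
      _ ≤ l ^ 12 := pow_le_pow_right₀ hl1 (by norm_num)
  have hl2 : l ^ 2 ≤ l ^ 12 := pow_le_pow_right₀ hl1 (by norm_num)
  have hl10 : l ^ 10 ≤ l ^ 12 := pow_le_pow_right₀ hl1 (by norm_num)
  have hT4 : T ^ (κ + 4 * η) ≤ T ^ (κ + 12 * η) := Real.rpow_le_rpow_of_exponent_le hT1 (by linarith)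
  have hTη : T ^ (κ + η) ≤ T ^ (κ + 12 * η) := Real.rpow_le_rpow_of_exponent_le hT1 (by linarith)
  have hTκ : T ^ κ ≤ T ^ (κ + 12 * η) := Real.rpow_le_rpow_of_exponent_le hT1 (by linarith)
  have hP0 : 0 ≤ l ^ 12 * T ^ (κ + 12 * η) := by positivity
  -- each term `≤ Kᵢ l¹² T^{κ+12η}`
  have hB1 : (18 * 17 ^ 3 * 20000 * C_b * C_d ^ 2) * l ^ 5 * T ^ (κ + 4 * η) ≤
      (18 * 17 ^ 3 * 20000 * C_b * C_d ^ 2) * (l ^ 12 * T ^ (κ + 12 * η)) := by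
    rw [mul_assoc]
    exact mul_le_mul_of_nonneg_left (mul_le_mul hl5 hT4 (by positivity) (by positivity)) (by positivity)
  have hB2 : (1458 * 17 ^ 7 * 10 ^ 4 * 800 * C_b * C_d ^ 6) * l ^ 12 * T ^ (κ + 12 * η) =
      (1458 * 17 ^ 7 * 10 ^ 4 * 800 * C_b * C_d ^ 6) * (l ^ 12 * T ^ (κ + 12 * η)) := by ring
  have hB3 : (200 * 2 ^ 40 * 16 * 4 * C₄) * l * T ^ (κ + η) ≤
      (200 * 2 ^ 40 * 16 * 4 * C₄) * (l ^ 12 * T ^ (κ + 12 * η)) := by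
    rw [mul_assoc]
    exact mul_le_mul_of_nonneg_left (mul_le_mul hl1' hTη (by positivity) (by positivity)) (by positivity)
  have hB4 : (C_c * 2 * (200 * 2 ^ 20 * 4)) * l ^ 2 * T ^ κ ≤
      (C_c * 2 * (200 * 2 ^ 20 * 4)) * (l ^ 12 * T ^ (κ + 12 * η)) := by
    rw [mul_assoc]
    exact mul_le_mul_of_nonneg_left (mul_le_mul hl2 hTκ (by positivity) (by positivity)) (by positivity)
  have hB5 : (C_c * 8 * (200 * 2 ^ 20 * 4) ^ 3 * 16) * l ^ 10 * T ^ κ ≤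
      (C_c * 8 * (200 * 2 ^ 20 * 4) ^ 3 * 16) * (l ^ 12 * T ^ (κ + 12 * η)) := by
    rw [mul_assoc]
    exact mul_le_mul_of_nonneg_left (mul_le_mul hl10 hTκ (by positivity) (by positivity)) (by positivity)
  calc (Z.card : ℝ) ≤ _ := hraw'
    _ ≤ (18 * 17 ^ 3 * 20000 * C_b * C_d ^ 2) * (l ^ 12 * T ^ (κ + 12 * η)) +
        (1458 * 17 ^ 7 * 10 ^ 4 * 800 * C_b * C_d ^ 6) * (l ^ 12 * T ^ (κ + 12 * η)) +
        (200 * 2 ^ 40 * 16 * 4 * C₄) * (l ^ 12 * T ^ (κ + 12 * η)) +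
        (C_c * 2 * (200 * 2 ^ 20 * 4)) * (l ^ 12 * T ^ (κ + 12 * η)) +
        (C_c * 8 * (200 * 2 ^ 20 * 4) ^ 3 * 16) * (l ^ 12 * T ^ (κ + 12 * η)) := by
        linarith [hI1, hI2, hIIa, hIIb1, hIIb2, hB1, hB2, hB3, hB4, hB5]
    _ = K * l ^ 12 * T ^ (κ + 12 * η) := by rw [hK]; ring


/-! ## §9. Thinning and the zero-density estimate -/

/-- **The well-spaced count** (Huxley (28.19) before the summation over `T`): for `3/4 ≤ σ < 1`,
`0 < η ≤ 1/24`, there are `U₀, C` such that every finite set of zeros `ρ = β + iγ` of `ζ` with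
`β ≥ σ`, `U < γ ≤ 2U` (`U ≥ U₀`) and ordinates pairwise `≥ 1` apart has at most
`C U^{κ(σ) + 13η}` elements: thin the set by `⌊γ⌋ mod k`, `k = ⌈300 log 2U⌉ + 1`
(`card_le_of_thinning`), apply `card_sep_le` to each class, and absorb `log¹³(2U) ≤ C_η U^η`.
[cite: Huxley1972, Ch. 28, (28.1) and (28.19)] -/
theorem wellSpaced_huxley (h4 : zetaFourthMomentWeak) {σ : ℝ} (hσ : 3 / 4 ≤ σ) (hσ1 : σ < 1) {η : ℝ}
    (hη : 0 < η) (hη1 : η ≤ 1 / 24) :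
    ∃ U₀ C : ℝ, 1 ≤ U₀ ∧ 0 ≤ C ∧ ∀ U : ℝ, U₀ ≤ U → ∀ Z : Finset ℂ,
      (∀ ρ ∈ Z, riemannZeta ρ = 0 ∧ σ ≤ ρ.re ∧ U < ρ.im ∧ ρ.im ≤ 2 * U) →
      (∀ ρ ∈ Z, ∀ ρ' ∈ Z, ρ ≠ ρ' → 1 ≤ |ρ.im - ρ'.im|) →
      (Z.card : ℝ) ≤ C * U ^ ((5 * σ - 3) * (1 - σ) / (σ ^ 2 + σ - 1) + 13 * η) := by
  classical
  obtain ⟨U₀, C, hU₀, hC0, hbd⟩ := card_sep_le h4 hσ hσ1 hη hη1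
  set κ : ℝ := (5 * σ - 3) * (1 - σ) / (σ ^ 2 + σ - 1) with hκ
  obtain ⟨-, -, -, -, -, -, -, ⟨hk1, hk2⟩⟩ := huxley_exponents hσ hσ1
  refine ⟨U₀, 302 * C * (13 / η) ^ 13 * 8, hU₀, by positivity, fun U hU Z hZ hsep ↦ ?_⟩
  have hU1 : 1 ≤ U := hU₀.trans hU
  set T : ℝ := 2 * U with hT
  have hT2 : 2 ≤ T := by rw [hT]; linarith
  have hT0 : 0 < T := by linarith
  have hT1 : 1 ≤ T := by linarith
  set l : ℝ := Real.log T with hl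
  have hl0 : 0 ≤ l := Real.log_nonneg hT1
  set A : ℝ := 100 * l with hA
  set k : ℕ := ⌈3 * A⌉₊ + 1 with hk
  have hk1' : 1 ≤ k := by rw [hk]; omega
  have hkA : 3 * A ≤ (k : ℝ) - 1 := by
    rw [hk]; push_cast
    have := Nat.le_ceil (3 * A)
    linarith
  have hkle : (k : ℝ) ≤ 302 * l + 2 := by
    rw [hk]; push_cast
    have := (Nat.ceil_lt_add_one (by positivity : (0 : ℝ) ≤ 3 * A)).le
    rw [hA] at this; linarith
  -- thinning
  have hpos : ∀ ρ ∈ Z, 0 ≤ ρ.im := fun ρ hρ ↦ by linarith [(hZ ρ hρ).2.2.1]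
  have hB : ∀ Z' ⊆ Z, (∀ ρ ∈ Z', ∀ ρ' ∈ Z', ρ ≠ ρ' → (k : ℝ) - 1 ≤ |ρ.im - ρ'.im|) →
      (Z'.card : ℝ) ≤ C * l ^ 12 * T ^ (κ + 12 * η) := by
    intro Z' hZ' hsep'
    refine hbd U hU Z' (fun ρ hρ ↦ hZ ρ (hZ' hρ)) fun ρ hρ ρ' hρ' hne ↦ ?_
    rw [← hT, ← hl, ← hA]
    exact hkA.trans (hsep' ρ hρ ρ' hρ' hne)
  have hthin := card_le_of_thinning Z hk1' hpos hsep hB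
  -- `l ≤ (13/η) T^{η/13}`
  have hlog : l ≤ T ^ (η / 13) / (η / 13) := Real.log_le_rpow_div hT0.le (by positivity)
  -- `T^{κ+13η} ≤ 4 U^{κ+13η}`
  have hTU : T ^ (κ + 13 * η) ≤ 4 * U ^ (κ + 13 * η) := by
    rw [hT, Real.mul_rpow (by norm_num) (by linarith)]
    refine mul_le_mul_of_nonneg_right ?_ (by positivity)
    calc (2 : ℝ) ^ (κ + 13 * η) ≤ (2 : ℝ) ^ (2 : ℝ) :=
          Real.rpow_le_rpow_of_exponent_le (by norm_num) (by linarith)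
      _ = 4 := by norm_num
  have hTT : T ^ (κ + 12 * η) * T ^ η = T ^ (κ + 13 * η) := by
    rw [← Real.rpow_add hT0]; congr 1; ring
  have hk302 : (k : ℝ) ≤ 302 * (l + 1) := by linarith
  -- bound `k l¹² ≤ 302 (l + 1) l¹²` and `(l + 1) l¹² ≤ 2 (13/η)¹³ T^η` via `l ≤ (13/η) T^{η/13}`
  have hl' : l ≤ 13 / η * T ^ (η / 13) := by
    have e : T ^ (η / 13) / (η / 13) = 13 / η * T ^ (η / 13) := by field_simp
    rw [← e]; exact hlog
  have h13η : (1 : ℝ) ≤ 13 / η := by rw [le_div_iff₀ hη]; linarith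
  have hTη1 : 1 ≤ T ^ (η / 13) := Real.one_le_rpow hT1 (by positivity)
  have hl1' : l + 1 ≤ 2 * (13 / η * T ^ (η / 13)) := by
    have : (1 : ℝ) ≤ 13 / η * T ^ (η / 13) := one_le_mul_of_one_le_of_one_le h13η hTη1
    linarith
  have hpow13 : (13 / η * T ^ (η / 13)) ^ 13 = (13 / η) ^ 13 * T ^ η := by
    rw [mul_pow, ← Real.rpow_natCast (T ^ (η / 13)), ← Real.rpow_mul hT0.le]
    congr 2; push_cast; ring
  have hmain : (l + 1) * l ^ 12 ≤ 2 * ((13 / η) ^ 13 * T ^ η) := by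
    have h1 : l ^ 12 ≤ (13 / η * T ^ (η / 13)) ^ 12 := pow_le_pow_left₀ hl0 hl' 12
    calc (l + 1) * l ^ 12 ≤ (2 * (13 / η * T ^ (η / 13))) * (13 / η * T ^ (η / 13)) ^ 12 :=
          mul_le_mul hl1' h1 (by positivity) (by positivity)
      _ = 2 * (13 / η * T ^ (η / 13)) ^ 13 := by ring
      _ = 2 * ((13 / η) ^ 13 * T ^ η) := by rw [hpow13]
  calc (Z.card : ℝ) ≤ k * (C * l ^ 12 * T ^ (κ + 12 * η)) := hthin
    _ ≤ (302 * (l + 1)) * (C * l ^ 12 * T ^ (κ + 12 * η)) :=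
        mul_le_mul_of_nonneg_right hk302 (by positivity)
    _ = 302 * C * ((l + 1) * l ^ 12) * T ^ (κ + 12 * η) := by ring
    _ ≤ 302 * C * (2 * ((13 / η) ^ 13 * T ^ η)) * T ^ (κ + 12 * η) := by gcongr
    _ = 302 * C * (13 / η) ^ 13 * 2 * (T ^ (κ + 12 * η) * T ^ η) := by ring
    _ = 302 * C * (13 / η) ^ 13 * 2 * T ^ (κ + 13 * η) := by rw [hTT]
    _ ≤ 302 * C * (13 / η) ^ 13 * 2 * (4 * U ^ (κ + 13 * η)) := by gcongr
    _ = 302 * C * (13 / η) ^ 13 * 8 * U ^ (κ + 13 * η) := by ring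

end HuxleyZeroDensity

/-- **Discharge of the named fact `Literature.NumberTheory.LFunctions.Huxley1972_zeroDensity`** (Huxley, *The Distribution of
Prime Numbers* (1972), Ch. 28, (28.19): `N(α, T) ≪ T^{(5α−3)(1−α)/(α²+α−1)} l^{27}` for
`3/4 ≤ α ≤ 1`, in the `T^ε` form `ZeroDensityEstimate`). Unconditional: Huxley's zero-detection
method with Mellin's kernel (`HuxleyZeroDetection`, here with the class (ii) condition kept as a
short integral, `HuxleyZeroDensity.zeroDetection_integral`), his large-values theorem (27.27)
(`Huxley1972_largeValues_holds`) for the class (i) zeros and for the large values of the mollifier,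
and — in place of the discrete fourth moment (22.22) — the fourth moment of `ζ` on disjoint windows
(`zetaFourthMomentWeak`, from the approximate functional equation); parameters (28.17)–(28.18);
representatives on unit windows (Jensen) and dyadic summation (`ZeroDensityInghamTools`); `σ = 1`
has no zeros. [cite: Huxley1972, Ch. 28, eq. (28.19)] -/
theorem Huxley1972_zeroDensity_holds : Huxley1972_zeroDensity := by
  intro ε hε σ h₀ h₁
  rcases h₁.eq_or_lt with h | hσ1
  · -- `σ = 1`: no zeros
    subst h
    refine Asymptotics.IsBigO.of_bound 1 (Eventually.of_forall fun T ↦ ?_)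
    rw [zetaZeroCountRe_eq_zero_of_one_le le_rfl]
    simp only [Nat.cast_zero, norm_zero, one_mul]
    exact norm_nonneg _
  · -- `3/4 ≤ σ < 1`
    have h4 : zetaFourthMomentWeak := zetaFourthMomentWeak_of_eq43 LFunctions.Bourgain2017_eq43_holds
    set η : ℝ := min (ε / 14) (1 / 24) with hη
    have hη0 : 0 < η := by rw [hη]; exact lt_min (by linarith) (by norm_num)
    have hηε : 14 * η ≤ ε := by
      have : η ≤ ε / 14 := min_le_left _ _
      linarith
    have hη1 : η ≤ 1 / 24 := min_le_right _ _
    obtain ⟨U₀, C, hU₀, hC0, hws⟩ := HuxleyZeroDensity.wellSpaced_huxley h4 h₀ hσ1 hη0 hη1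
    obtain ⟨-, -, -, -, -, -, -, ⟨hk1, -⟩⟩ := HuxleyZeroDensity.huxley_exponents h₀ hσ1
    obtain ⟨C', hC'0, hwsb⟩ := ZeroDensity.wellSpacedBound_of_eventually (by linarith) (by positivity)
      hU₀ hC0 hws
    obtain ⟨Cw, hCw0, hCw⟩ := LFunctions.exists_sum_zetaZeroWindow_le
    have hdy : ∀ U : ℝ, 1 ≤ U → (zetaZeroCountRe σ (2 * U) : ℝ) - zetaZeroCountRe σ U ≤
        (2 * C' * Cw) * U ^ ((5 * σ - 3) * (1 - σ) / (σ ^ 2 + σ - 1) + 13 * η) * Real.log (2 * U + 3) := by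
      intro U hU
      have := ZeroDensity.count_dyadic_le (by linarith) hwsb hCw hU
      calc (zetaZeroCountRe σ (2 * U) : ℝ) - zetaZeroCountRe σ U
          ≤ 2 * C' * U ^ ((5 * σ - 3) * (1 - σ) / (σ ^ 2 + σ - 1) + 13 * η) * (Cw * Real.log (2 * U + 3)) := this
        _ = (2 * C' * Cw) * U ^ ((5 * σ - 3) * (1 - σ) / (σ ^ 2 + σ - 1) + 13 * η) * Real.log (2 * U + 3) := by ring
    have hbig := ZeroDensity.isBigO_of_dyadic (by positivity) (by positivity) hdy hη0
    refine hbig.trans (isBigO_rpow_rpow_atTop_of_le ?_)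
    have e : (5 * σ - 3) * (1 - σ) / (σ ^ 2 + σ - 1) = (5 * σ - 3) / (σ ^ 2 + σ - 1) * (1 - σ) := by ring
    linarith

/-- **Discharge of the named fact `Literature.NumberTheory.LFunctions.zeroDensity_huxley`** (rh.S12, Huxley's `12/5` density
theorem: `N(σ, T) ≪_ε T^{(12/5)(1−σ)+ε}` for `1/2 ≤ σ ≤ 1`; Huxley 1972 (28.19) with Ingham 1940
below `σ = 3/4`; Titchmarsh §9.29; Iwaniec–Kowalski §10.5): unconditional, from
`zeroDensity_ingham_holds` (`ZeroDensityIngham.lean`) and `Huxley1972_zeroDensity_holds` through the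
assembly `zeroDensity_huxley_of_ingham_of_huxley1972` (`ZeroDensityInghamHuxley.lean`).
[cite: Huxley1972, Ch. 28, (28.19) and (28.30)] [cite: Titchmarsh1986, §9.29] -/
theorem zeroDensity_huxley_holds : zeroDensity_huxley :=
  zeroDensity_huxley_of_ingham_of_huxley1972 zeroDensity_ingham_holds Huxley1972_zeroDensity_holds

end Literature.NumberTheory.LFunctions
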